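import Literature.Barriers.Parity.FordFixedLevel
import Literature.NumberTheory.Sieve.FordAsymptoticSieveProofs
import Literature.NumberTheory.Sieve.FordAsymptoticSieve
import Literature.NumberTheory.Sieve.BombieriAsymptoticSieveLemma3
import Literature.NumberTheory.LFunctions.PrimeNumberTheoremErrorTermProofs
import HarnessLib

/-!
# `FordFixedLevel` — companion ("Proofs") file: Theorem 1 of [Ford2004] from the local construction

Topic `Literature/Barriers/Parity`, companion of the catalogue entry `FordFixedLevel.lean` (Ford's
fixed-level barrier for Bombieri's asymptotic sieve, D-0021), kept separate so that the statement
file and its light import graph are unchanged. All declarations in this file are PROVED theorems;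
there are no new definitions (the end-points `x_j` and the glued sequence are handled through
hypotheses `xs 0 = X₀`, `xs (j+1) = xs j (1 + η(xs j))` and an existence lemma, `Ford2004.exists_glue`).

Main result:

* `FordFixedLevelBarrier_of_localConstruction :
    Literature.NumberTheory.Sieve.Ford2004_localConstruction → FordFixedLevelBarrier` —
  the deduction of [Ford2004] Theorem 1 (first assertion; the tree's barrier
  `Literature.Barriers.Parity.FordFixedLevelBarrier`) from the LOCAL construction on one short
  interval `I = (x, x + x e^{−c₁√log x}]` (properties (2.3)–(2.5) of [Ford2004] §2, i.e. Theorem 3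
  with the choice of `f_{1_M}` made in the proof of Theorem 1; vendored as the named fact
  `Ford2004_localConstruction` in `Literature/NumberTheory/Sieve/FordAsymptoticSieve.lean`).
  This is the paragraph "Deducing Theorems 1 and 2 from (2.3)–(2.6) is straightforward" of
  [Ford2004] §2 (arXiv p. 5), written out: with `x_{j+1} = x_j(1 + e^{−c₁√log x_j})`,
  `I_j = (x_j, x_{j+1}] ∩ ℤ`, `K_j = |I_j|` and `a_n` given by the local construction on each `I_j`
  (sign `σ_j = +1` throughout, i.e. case (ii) of Theorem 1; `a_n = 1` for `n ≤ x_0`),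
  - `R(ν)`: for `d ≤ x^ν`, `A_d(x) = O(x^{ν+ϖ}/d) + ∑_{x^{ν+ϖ} ≤ x_j ≤ x} (K_j/d)(1 + O(e^{−c₁√((ν+ϖ) log x)}))
    = x/d + O((x/d) e^{−c√log x})` (`Ford2004.typeI_pointwise`), and summing over `d ≤ x^ν` costs a
    factor `1 + log x` (`Ford2004.typeI_isBigO`);
  - failure of `(S_k)`: `∑_{n ≤ x} a_n Λ_k(n) = ∑_{n ≤ x} Λ_k(n) + ∑_{n ≤ x} (a_n − 1) Λ_k(n)`; the
    first sum is `∼ k x (log x)^{k−1}` (`Ford2004.isLittleO_sum_generalizedVonMangoldt_sub`), the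
    second is `≥ (θ_k/2) x (log x)^{k−1}` for large `x` (`Ford2004.eventually_perturbation_ge`:
    intervals below `x/(log x)^3` and the incomplete top interval are bounded by `Λ_k(n) ≤ (log n)^k`,
    the complete intervals in between by (2.5)), so `T_k(x) ↛ 1`
    (`Ford2004.not_isEquivalent_of_local`).

Analytic inputs (all PROVED in the tree): the prime number theorem with the de la Vallée Poussin
error term `Literature.NumberTheory.LFunctions.ChebyshevPsiDeLaValleePoussin_holds` ([Ford2004]
Lemma 2.1) for `k = 1`, [FriedlanderIwaniecPisa1978] Lemma 3
`Literature.NumberTheory.Sieve.BombieriSieve.FI1978_lemma3_rat_explicit`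
(`∑_{n ≤ x} Λ_k(n) = k x (log x)^{k−1} + O_k(x (log x)^{k−2})`) for `k ≥ 2`, and the `Λ_k` toolkit
of `ParityBarrierProofs.lean` (`0 ≤ Λ_k(n) ≤ (log n)^k`).

What is NOT here: the local construction itself ([Ford2004] Lemma 2.2 and §3, Theorem 3), which
remains the named fact `Ford2004_localConstruction`; consequently `FordFixedLevelBarrier` is reduced
to, but not yet discharged from, that single fact. Cases (i) and (iii) of Theorem 1 and Theorem 2
are not transcribed in the barrier and are not treated.

## References

* K. Ford, *On Bombieri's asymptotic sieve*, Trans. Amer. Math. Soc. 357 (2005), 1663–1674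
  (arXiv math/0401215), §2 (2.1)–(2.5) and p. 5, Theorem 1 [Ford2004] (held; read pp. 3–9).
* J. Friedlander, H. Iwaniec, *On Bombieri's asymptotic sieve*, Ann. Scuola Norm. Sup. Pisa (4) 5
  (1978), 719–756, Lemma 3 [FriedlanderIwaniecPisa1978] (through the tree).
* H. L. Montgomery, R. C. Vaughan, *Multiplicative Number Theory I*, CUP 2007, Theorem 6.9
  [MontgomeryVaughan2007] (through the tree).
-/

noncomputable section

open Filter Asymptotics Finset Real Topology
open Literature.NumberTheory.Sieve Literature.NumberTheory.LFunctions

namespace Literature.Barriers.Parity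

namespace Ford2004

/-! ## Analytic helpers: `η_c(x) = e^{-c√log x}` beats every power of `log` -/

/-- `η_c(x) ≤ C_A / (log x)^A` for `x ≥ 2` (`c > 0`, any real `A`), with `C_A ≥ 0`: the de la
Vallée Poussin factor beats every power of `log` (Montgomery–Vaughan §6.2; the tree's
`logPow_of_expSqrt`). [folklore] -/
theorem eta_le_div_logPow {c : ℝ} (hc : 0 < c) (A : ℝ) :
    ∃ C : ℝ, 0 ≤ C ∧ ∀ x : ℝ, 2 ≤ x → Ford2004.eta c x ≤ C / Real.log x ^ A := by
  have h := logPow_of_expSqrt (f := fun x => x + x / Real.exp (c * Real.sqrt (Real.log x)))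
    (C := 1) hc (fun x hx => by
      have hx0 : 0 < x := by linarith
      rw [add_sub_cancel_left, one_mul, abs_of_nonneg (by positivity)]) A
  obtain ⟨C', hC'⟩ := h
  refine ⟨max C' 0, le_max_right _ _, fun x hx => ?_⟩
  have hx0 : 0 < x := by linarith
  have h1 := hC' x hx
  rw [add_sub_cancel_left, abs_of_nonneg (by positivity)] at h1
  have hL : 0 ≤ Real.log x ^ A := Real.rpow_nonneg (Real.log_nonneg (by linarith)) A
  have h2 : x / Real.exp (c * Real.sqrt (Real.log x)) ≤ max C' 0 * x / Real.log x ^ A := by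
    refine h1.trans ?_
    rw [mul_div_assoc, mul_div_assoc]
    exact mul_le_mul_of_nonneg_right (le_max_left _ _) (by positivity)
  rw [Ford2004.eta, Real.exp_neg]
  -- divide `h2` by `x > 0`
  have h3 : x * (Real.exp (c * Real.sqrt (Real.log x)))⁻¹ ≤ x * (max C' 0 / Real.log x ^ A) := by
    calc x * (Real.exp (c * Real.sqrt (Real.log x)))⁻¹
        = x / Real.exp (c * Real.sqrt (Real.log x)) := by rw [div_eq_mul_inv]
      _ ≤ max C' 0 * x / Real.log x ^ A := h2
      _ = x * (max C' 0 / Real.log x ^ A) := by ring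
  exact le_of_mul_le_mul_left h3 hx0

/-- `η_c(x^α) = η_{c√α}(x)` for `x > 0`, `α ≥ 0` (`log x^α = α log x`). [folklore] -/
theorem eta_rpow {c α x : ℝ} (hα : 0 ≤ α) (hx : 0 < x) :
    Ford2004.eta c (x ^ α) = Ford2004.eta (c * Real.sqrt α) x := by
  rw [Ford2004.eta, Ford2004.eta, Real.log_rpow hx, Real.sqrt_mul hα, mul_assoc]

/-- `η_c(√x) = η_{c√(1/2)}(x)` for `x > 0`. [folklore] -/
theorem eta_sqrt {c x : ℝ} (hx : 0 < x) :
    Ford2004.eta c (Real.sqrt x) = Ford2004.eta (c * Real.sqrt (1 / 2)) x := by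
  rw [Real.sqrt_eq_rpow, eta_rpow (by norm_num) hx]

/-- `η_c(u) ≤ η_{c√(1/2)}(x)` whenever `√x ≤ u` (`c ≥ 0`, `x > 0`): `η_c` is non-increasing. [folklore] -/
theorem eta_le_eta_half {c x u : ℝ} (hc : 0 ≤ c) (hx : 0 < x) (hu : Real.sqrt x ≤ u) :
    Ford2004.eta c u ≤ Ford2004.eta (c * Real.sqrt (1 / 2)) x := by
  rw [← eta_sqrt hx]
  exact Ford2004.eta_antitone hc (Real.sqrt_pos.mpr hx) hu

/-- `η_c(x) → 0` as `x → ∞` (`c > 0`). [folklore] -/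
theorem tendsto_eta {c : ℝ} (hc : 0 < c) : Tendsto (Ford2004.eta c) atTop (𝓝 0) := by
  have h1 : Tendsto (fun x => c * Real.sqrt (Real.log x)) atTop atTop :=
    (Real.tendsto_sqrt_atTop.comp Real.tendsto_log_atTop).const_mul_atTop hc
  exact Real.tendsto_exp_neg_atTop_nhds_zero.comp h1

/-- Absorption of the de la Vallée Poussin factor: for `c > 0` and all real `B`, `M`,
eventually `M · x η_c(x) · (1 + log x) ≤ x / (log x)^B`. [folklore] -/
theorem eventually_eta_absorb {c : ℝ} (hc : 0 < c) (B M : ℝ) :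
    ∀ᶠ x : ℝ in atTop, M * (x * Ford2004.eta c x) * (1 + Real.log x) ≤ x / Real.log x ^ B := by
  obtain ⟨C, hC0, hC⟩ := eta_le_div_logPow hc (B + 2)
  filter_upwards [eventually_ge_atTop (2 : ℝ),
    (Real.tendsto_log_atTop.eventually_ge_atTop (max 1 (2 * (|M| * C))))] with x hx hlog
  have hx0 : 0 < x := by linarith
  have hL1 : 1 ≤ Real.log x := le_trans (le_max_left _ _) hlog
  have hL0 : 0 < Real.log x := by linarith
  have hLB : 0 < Real.log x ^ B := Real.rpow_pos_of_pos hL0 B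
  have hsplit : Real.log x ^ (B + 2) = Real.log x ^ B * Real.log x ^ 2 := by
    rw [Real.rpow_add hL0, Real.rpow_two]
  have hη0 : 0 ≤ Ford2004.eta c x := (Ford2004.eta_pos c x).le
  -- `M x η (1 + log x) ≤ |M| x (C / log^{B+2} x) (2 log x)`
  have h1 : M * (x * Ford2004.eta c x) * (1 + Real.log x) ≤
      |M| * (x * (C / Real.log x ^ (B + 2))) * (2 * Real.log x) := by
    have ha : M * (x * Ford2004.eta c x) * (1 + Real.log x) ≤
        |M| * (x * Ford2004.eta c x) * (1 + Real.log x) :=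
      mul_le_mul_of_nonneg_right (mul_le_mul_of_nonneg_right (le_abs_self M) (by positivity))
        (by linarith)
    refine ha.trans ?_
    have hb : x * Ford2004.eta c x ≤ x * (C / Real.log x ^ (B + 2)) :=
      mul_le_mul_of_nonneg_left (hC x hx) hx0.le
    have hc' : 1 + Real.log x ≤ 2 * Real.log x := by linarith
    exact mul_le_mul (mul_le_mul_of_nonneg_left hb (abs_nonneg M)) hc' (by linarith)
      (by positivity)
  refine h1.trans ?_
  rw [hsplit]
  set P := Real.log x ^ B with hP
  set L := Real.log x with hL
  have hP0 : P ≠ 0 := hLB.ne'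
  have hL0' : L ≠ 0 := hL0.ne'
  have hfrac : (2 * (|M| * C)) / L ≤ 1 := by
    rw [div_le_one hL0]
    exact le_trans (le_max_right _ _) hlog
  calc |M| * (x * (C / (P * L ^ 2))) * (2 * L)
      = (x / P) * ((2 * (|M| * C)) / L) := by
        field_simp
    _ ≤ (x / P) * 1 := mul_le_mul_of_nonneg_left hfrac (by positivity)
    _ = x / P := mul_one _

/-- Absorption of a power saving: for `s < 1` and all real `B`, `M`, eventually
`M · x^s · (1 + log x) ≤ x / (log x)^B`. [folklore] -/
theorem eventually_rpow_absorb {s : ℝ} (hs : s < 1) (B M : ℝ) :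
    ∀ᶠ x : ℝ in atTop, M * x ^ s * (1 + Real.log x) ≤ x / Real.log x ^ B := by
  have hlo := isLittleO_log_rpow_rpow_atTop (B + 1) (show 0 < 1 - s by linarith)
  have hpos : 0 < 1 / (2 * |M| + 1) := by positivity
  filter_upwards [hlo.def hpos, eventually_ge_atTop (1 : ℝ),
    Real.tendsto_log_atTop.eventually_ge_atTop (1 : ℝ)] with x hx hx1 hL1
  have hx0 : 0 < x := by linarith
  have hL0 : 0 < Real.log x := by linarith
  have hLB : 0 < Real.log x ^ B := Real.rpow_pos_of_pos hL0 B
  rw [Real.norm_of_nonneg (Real.rpow_nonneg hL0.le _),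
    Real.norm_of_nonneg (Real.rpow_nonneg hx0.le _)] at hx
  have hsplit : Real.log x ^ (B + 1) = Real.log x ^ B * Real.log x := by
    rw [Real.rpow_add hL0, Real.rpow_one]
  have hxsplit : x = x ^ s * x ^ (1 - s) := by
    rw [← Real.rpow_add hx0]; norm_num
  have key : M * (1 + Real.log x) * Real.log x ^ B ≤ x ^ (1 - s) := by
    have ha : M * (1 + Real.log x) * Real.log x ^ B ≤ |M| * (1 + Real.log x) * Real.log x ^ B :=
      mul_le_mul_of_nonneg_right (mul_le_mul_of_nonneg_right (le_abs_self M) (by linarith))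
        hLB.le
    have hb : |M| * (1 + Real.log x) * Real.log x ^ B ≤ |M| * (2 * Real.log x) * Real.log x ^ B :=
      mul_le_mul_of_nonneg_right (mul_le_mul_of_nonneg_left (by linarith) (abs_nonneg M)) hLB.le
    have hc : |M| * (2 * Real.log x) * Real.log x ^ B = 2 * |M| * Real.log x ^ (B + 1) := by
      rw [hsplit]; ring
    refine ha.trans (hb.trans ?_)
    rw [hc]
    calc 2 * |M| * Real.log x ^ (B + 1)
        ≤ 2 * |M| * (1 / (2 * |M| + 1) * x ^ (1 - s)) :=
          mul_le_mul_of_nonneg_left hx (by positivity)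
      _ = (2 * |M| / (2 * |M| + 1)) * x ^ (1 - s) := by ring
      _ ≤ 1 * x ^ (1 - s) := by
          refine mul_le_mul_of_nonneg_right ?_ (Real.rpow_nonneg hx0.le _)
          rw [div_le_one (by positivity)]
          linarith
      _ = x ^ (1 - s) := one_mul _
  rw [le_div_iff₀ hLB]
  conv_rhs => rw [hxsplit]
  calc M * x ^ s * (1 + Real.log x) * Real.log x ^ B
      = x ^ s * (M * (1 + Real.log x) * Real.log x ^ B) := by ring
    _ ≤ x ^ s * x ^ (1 - s) := mul_le_mul_of_nonneg_left key (Real.rpow_nonneg hx0.le _)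

/-- Absorption of a logarithm: for all real `B`, `M`, eventually `M (1 + log x) ≤ x/(log x)^B`. [folklore] -/
theorem eventually_const_absorb (B M : ℝ) :
    ∀ᶠ x : ℝ in atTop, M * (1 + Real.log x) ≤ x / Real.log x ^ B := by
  filter_upwards [eventually_rpow_absorb (show (0 : ℝ) < 1 by norm_num) B M] with x hx
  simpa [Real.rpow_zero] using hx



/-! ## The end-points `x_j` ([Ford2004] (2.2)): `x_{j+1} = x_j (1 + η_{c}(x_j))` -/

section Endpoints

variable {c X₀ : ℝ} {xs : ℕ → ℝ}

/-- `x_j > 0`. [cite: Ford2004, §2 (2.2)] -/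
theorem xs_pos (hX : 0 < X₀) (h0 : xs 0 = X₀)
    (hrec : ∀ j, xs (j + 1) = xs j + xs j * Ford2004.eta c (xs j)) (j : ℕ) : 0 < xs j := by
  induction j with
  | zero => rwa [h0]
  | succ j ih =>
    rw [hrec]
    exact add_pos_of_pos_of_nonneg ih (mul_nonneg ih.le (Ford2004.eta_pos c _).le)

/-- `x_j ≤ x_{j+1}`. [cite: Ford2004, §2 (2.2)] -/
theorem xs_le_succ (hX : 0 < X₀) (h0 : xs 0 = X₀)
    (hrec : ∀ j, xs (j + 1) = xs j + xs j * Ford2004.eta c (xs j)) (j : ℕ) : xs j ≤ xs (j + 1) := by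
  rw [hrec]
  exact le_add_of_nonneg_right (mul_nonneg (xs_pos hX h0 hrec j).le (Ford2004.eta_pos c _).le)

/-- `j ↦ x_j` is monotone. [cite: Ford2004, §2 (2.2)] -/
theorem xs_mono (hX : 0 < X₀) (h0 : xs 0 = X₀)
    (hrec : ∀ j, xs (j + 1) = xs j + xs j * Ford2004.eta c (xs j)) : Monotone xs :=
  monotone_nat_of_le_succ (xs_le_succ hX h0 hrec)

/-- `x_{j+1} ≤ 2 x_j` (as `η ≤ 1` for `c ≥ 0`). [cite: Ford2004, §2 (2.2)] -/
theorem xs_succ_le (hc : 0 ≤ c) (hX : 0 < X₀) (h0 : xs 0 = X₀)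
    (hrec : ∀ j, xs (j + 1) = xs j + xs j * Ford2004.eta c (xs j)) (j : ℕ) :
    xs (j + 1) ≤ 2 * xs j := by
  rw [hrec]
  have h1 := mul_le_mul_of_nonneg_left (Ford2004.eta_le_one hc (xs j)) (xs_pos hX h0 hrec j).le
  linarith

/-- The end-points are unbounded: `x_j → ∞` (if `x_j ≤ b` for all `j` then `η_c(x_j) ≥ η_c(b) > 0`
and `x_j ≥ x_0 (1 + η_c(b))^j`). [cite: Ford2004, §2 (2.2)] -/
theorem xs_unbounded (hc : 0 ≤ c) (hX : 0 < X₀) (h0 : xs 0 = X₀)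
    (hrec : ∀ j, xs (j + 1) = xs j + xs j * Ford2004.eta c (xs j)) (b : ℝ) : ∃ j, b < xs j := by
  by_contra h
  simp only [not_exists, not_lt] at h
  set e := Ford2004.eta c b with he
  have he0 : 0 < e := Ford2004.eta_pos c b
  have hgeom : ∀ j, X₀ * (1 + e) ^ j ≤ xs j := by
    intro j
    induction j with
    | zero => rw [h0, pow_zero, mul_one]
    | succ j ih =>
      have hη : e ≤ Ford2004.eta c (xs j) :=
        Ford2004.eta_antitone hc (xs_pos hX h0 hrec j) (h j)
      calc X₀ * (1 + e) ^ (j + 1) = X₀ * (1 + e) ^ j * (1 + e) := by ring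
        _ ≤ xs j * (1 + e) := mul_le_mul_of_nonneg_right ih (by linarith)
        _ ≤ xs j * (1 + Ford2004.eta c (xs j)) :=
            mul_le_mul_of_nonneg_left (by linarith) (xs_pos hX h0 hrec j).le
        _ = xs (j + 1) := by rw [hrec]; ring
  have ht : Tendsto (fun j : ℕ => (1 + e) ^ j) atTop atTop :=
    tendsto_pow_atTop_atTop_of_one_lt (by linarith)
  obtain ⟨j, hj⟩ := (ht.eventually_gt_atTop (b / X₀)).exists
  have h1 : b < X₀ * (1 + e) ^ j := by
    rw [div_lt_iff₀ hX] at hj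
    linarith
  linarith [hgeom j, h j]

/-- For `x ≥ x_0` there is `J` with `x_J ≤ x < x_{J+1}`. [cite: Ford2004, §2 (2.2)] -/
theorem exists_index (hc : 0 ≤ c) (hX : 0 < X₀) (h0 : xs 0 = X₀)
    (hrec : ∀ j, xs (j + 1) = xs j + xs j * Ford2004.eta c (xs j)) {x : ℝ} (hx : X₀ ≤ x) :
    ∃ J, xs J ≤ x ∧ x < xs (J + 1) := by
  classical
  have hex : ∃ j, x < xs j := xs_unbounded hc hX h0 hrec x
  have hJ0 : Nat.find hex ≠ 0 := by
    intro hJ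
    have h1 := Nat.find_spec hex
    rw [hJ, h0] at h1
    linarith
  refine ⟨Nat.find hex - 1, ?_, ?_⟩
  · exact not_lt.mp (Nat.find_min hex (Nat.sub_one_lt hJ0))
  · rw [Nat.sub_one_add_one hJ0]
    exact Nat.find_spec hex

/-- The first end-point beyond `y`: if `x_0 ≤ 2y` there is `j` with `y ≤ x_j ≤ 2y` and `x_i < y`
for `i < j`. [cite: Ford2004, §2 (2.2)] -/
theorem exists_first_index (hc : 0 ≤ c) (hX : 0 < X₀) (h0 : xs 0 = X₀)
    (hrec : ∀ j, xs (j + 1) = xs j + xs j * Ford2004.eta c (xs j)) {y : ℝ} (hy : X₀ ≤ 2 * y) :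
    ∃ j, y ≤ xs j ∧ xs j ≤ 2 * y ∧ ∀ i < j, xs i < y := by
  classical
  have hex : ∃ j, y ≤ xs j := by
    obtain ⟨j, hj⟩ := xs_unbounded hc hX h0 hrec y
    exact ⟨j, hj.le⟩
  refine ⟨Nat.find hex, Nat.find_spec hex, ?_, fun i hi => not_le.mp (Nat.find_min hex hi)⟩
  by_cases hz : Nat.find hex = 0
  · rw [hz, h0]; exact hy
  · obtain ⟨i, hi⟩ := Nat.exists_eq_succ_of_ne_zero hz
    have hlt : i < Nat.find hex := by omega
    have h1 := not_le.mp (Nat.find_min hex hlt)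
    have h2 := xs_succ_le hc hX h0 hrec i
    rw [hi]
    linarith

end Endpoints

/-! ## Consecutive blocks `(N_i, N_{i+1}]` of the positive integers -/

section Blocks

variable {N : ℕ → ℕ}

/-- Splitting `∑_{n ≤ N_J}` into `∑_{n ≤ N_j}` and the blocks `(N_i, N_{i+1}]`, `j ≤ i < J`, for a
monotone `N`. [folklore] -/
theorem sum_Ioc_eq_sum_blocks (hN : Monotone N) (f : ℕ → ℝ) {j J : ℕ} (hjJ : j ≤ J) :
    ∑ n ∈ Ioc 0 (N J), f n =
      ∑ n ∈ Ioc 0 (N j), f n + ∑ i ∈ Ico j J, ∑ n ∈ Ioc (N i) (N (i + 1)), f n := by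
  induction J, hjJ using Nat.le_induction with
  | base => simp
  | succ J hjJ ih =>
    rw [Finset.sum_Ico_succ_top hjJ, ← add_assoc, ← ih,
      Finset.sum_Ioc_consecutive f (Nat.zero_le _) (hN (Nat.le_succ J))]

/-- `N_J = N_j + ∑_{j ≤ i < J} #(N_i, N_{i+1}]` for a monotone `N` (in `ℝ`). [folklore] -/
theorem cast_eq_sum_card_blocks (hN : Monotone N) {j J : ℕ} (hjJ : j ≤ J) :
    (N J : ℝ) = N j + ∑ i ∈ Ico j J, ((Ioc (N i) (N (i + 1))).card : ℝ) := by
  have h := sum_Ioc_eq_sum_blocks hN (fun _ => (1 : ℝ)) hjJ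
  simpa using h

/-- A positive integer lies in at most one block. [folklore] -/
theorem block_unique (hN : Monotone N) {n i j : ℕ} (hi : n ∈ Ioc (N i) (N (i + 1)))
    (hj : n ∈ Ioc (N j) (N (j + 1))) : i = j := by
  rw [Finset.mem_Ioc] at hi hj
  by_contra hne
  rcases lt_or_gt_of_ne hne with h | h
  · have h1 := hN (show i + 1 ≤ j by omega)
    omega
  · have h1 := hN (show j + 1 ≤ i by omega)
    omega

/-- Gluing local data: given `a^{(j)}` on each block there is one sequence `a` agreeing with
`a^{(j)}` on the `j`-th block and equal to `1` off the blocks. [folklore] -/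
theorem exists_glue (hN : Monotone N) (aloc : ℕ → ℕ → ℝ) :
    ∃ a : ℕ → ℝ, (∀ j, ∀ n ∈ Ioc (N j) (N (j + 1)), a n = aloc j n) ∧
      (∀ n, (∀ j, n ∉ Ioc (N j) (N (j + 1))) → a n = 1) := by
  classical
  refine ⟨fun n => if h : ∃ j, n ∈ Ioc (N j) (N (j + 1)) then aloc (Nat.find h) n else 1,
    fun j n hn => ?_, fun n hn => ?_⟩
  · have h : ∃ j, n ∈ Ioc (N j) (N (j + 1)) := ⟨j, hn⟩
    simp only [dif_pos h]
    rw [block_unique hN (Nat.find_spec h) hn]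
  · simp only [dif_neg (not_exists.mpr hn)]

end Blocks

/-- The harmonic bound `∑_{d ≤ Q} 1/d ≤ 1 + log Q` (Mathlib's `harmonic_le_one_add_log`). [folklore] -/
theorem sum_Icc_one_div_le (Q : ℕ) : ∑ d ∈ Icc 1 Q, (1 : ℝ) / d ≤ 1 + Real.log Q := by
  rcases Nat.eq_zero_or_pos Q with rfl | hQ
  · simp
  have := harmonic_le_one_add_log Q
  rw [harmonic_eq_sum_Icc] at this
  push_cast at this
  simpa only [one_div] using this



/-! ## The Type-I estimate `R(ν)` ([Ford2004] §2, p. 5) -/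

section TypeI

variable {ν ϖ c C X₀ : ℝ} {xs : ℕ → ℝ} {aloc : ℕ → ℕ → ℝ} {a : ℕ → ℝ} {N : ℕ → ℕ}

/-- The glued sequence takes values in `[0, 2]` ((2.3)). [cite: Ford2004, §2 (2.3)] -/
theorem glue_bounds (h23 : ∀ j n, 0 ≤ aloc j n ∧ aloc j n ≤ 2)
    (ha : ∀ j, ∀ n ∈ Ioc (N j) (N (j + 1)), a n = aloc j n)
    (ha1 : ∀ n, (∀ j, n ∉ Ioc (N j) (N (j + 1))) → a n = 1) (n : ℕ) : 0 ≤ a n ∧ a n ≤ 2 := by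
  by_cases h : ∃ j, n ∈ Ioc (N j) (N (j + 1))
  · obtain ⟨j, hj⟩ := h
    rw [ha j n hj]
    exact h23 j n
  · rw [ha1 n (not_exists.mp h)]
    norm_num

/-- `∑_{n ≤ M, d ∣ n} a_n ≤ 2M/d` for a sequence with values in `[0, 2]`. [folklore] -/
theorem sum_filter_dvd_le (h02 : ∀ n, 0 ≤ a n ∧ a n ≤ 2) (M d : ℕ) :
    ∑ n ∈ (Ioc 0 M).filter (d ∣ ·), a n ≤ 2 * (M : ℝ) / d := by
  calc ∑ n ∈ (Ioc 0 M).filter (d ∣ ·), a n ≤ ∑ n ∈ (Ioc 0 M).filter (d ∣ ·), (2 : ℝ) :=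
        Finset.sum_le_sum fun n _ => (h02 n).2
    _ = 2 * ((M / d : ℕ) : ℝ) := by
        rw [Finset.sum_const, nsmul_eq_mul, Nat.Ioc_filter_dvd_card_eq_div, mul_comm]
    _ ≤ 2 * ((M : ℝ) / d) := by
        refine mul_le_mul_of_nonneg_left ?_ (by norm_num)
        exact Nat.cast_div_le
    _ = 2 * (M : ℝ) / d := by ring

/-- `√x ≤ x/2` for `x ≥ 4`. [folklore] -/
theorem sqrt_le_half {x : ℝ} (hx4 : 4 ≤ x) : Real.sqrt x ≤ x / 2 := by
  have hx0 : 0 ≤ x := by linarith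
  have hs2 : 2 ≤ Real.sqrt x := by
    rw [show (2 : ℝ) = Real.sqrt 4 by
      rw [show (4 : ℝ) = 2 ^ 2 by norm_num, Real.sqrt_sq (by norm_num : (0:ℝ) ≤ 2)]]
    exact Real.sqrt_le_sqrt hx4
  nlinarith [Real.mul_self_sqrt hx0, Real.sqrt_nonneg x]
set_option maxHeartbeats 400000 in -- buildfix (bf3-g27): 160k/180k FAIL, 200k PASS at accept time; line-neutral budget line
/-- **The Type-I estimate, one modulus** ([Ford2004] §2, p. 5, display for `A_d(x)`): for
`x` large and `1 ≤ d ≤ x^ν`, splitting `A_d(x)` at `x^{ν+ϖ}` (trivial bound `0 ≤ a_n ≤ 2` below,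
(2.4) on the intervals above, the last incomplete interval by positivity),
`|A_d(x) − x/d| ≤ E(x)/d` with
`E(x) = 4x^{ν+ϖ} + C x η_c(x^{ν+ϖ}) + (1 + C)(x η_c(√x) + 1)`. [cite: Ford2004, §2 p. 5 (deduction of R(ν) from (2.3)–(2.4))] -/
theorem typeI_pointwise
    (hν0 : 0 < ν) (hϖ0 : 0 < ϖ) (hϖ1 : ϖ < 1 - ν) (hc : 0 < c) (hC : 0 ≤ C) (hX : 2 ≤ X₀)
    (h0 : xs 0 = X₀) (hrec : ∀ j, xs (j + 1) = xs j + xs j * Ford2004.eta c (xs j))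
    (h02 : ∀ n, 0 ≤ a n ∧ a n ≤ 2)
    (ha : ∀ j, ∀ n ∈ Ioc ⌊xs j⌋₊ ⌊xs (j + 1)⌋₊, a n = aloc j n)
    (h24 : ∀ j (d : ℕ), 1 ≤ d → (d : ℝ) ≤ xs j ^ (1 - ϖ) →
      |(∑ n ∈ (Ioc ⌊xs j⌋₊ ⌊xs (j + 1)⌋₊).filter (d ∣ ·), aloc j n)
          - ((Ioc ⌊xs j⌋₊ ⌊xs (j + 1)⌋₊).card : ℝ) / d|
        ≤ C * (((Ioc ⌊xs j⌋₊ ⌊xs (j + 1)⌋₊).card : ℝ) / d * Ford2004.eta c (xs j)))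
    {x : ℝ} (hxX : X₀ ≤ x) (hx4 : 4 ≤ x) (hxlow : X₀ ≤ 2 * x ^ (ν + ϖ))
    (hxup : 2 * x ^ (ν + ϖ) ≤ x) {d : ℕ} (hd1 : 1 ≤ d) (hdx : (d : ℝ) ≤ x ^ ν) :
    |(∑ n ∈ (Ioc 0 ⌊x⌋₊).filter (d ∣ ·), a n) - x / d| ≤
      (4 * x ^ (ν + ϖ) + C * (x * Ford2004.eta c (x ^ (ν + ϖ)))
        + (1 + C) * (x * Ford2004.eta (c * Real.sqrt (1 / 2)) x + 1)) / d := by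
  -- basic positivity
  have hX0 : 0 < X₀ := by linarith
  have hx0 : 0 < x := by linarith
  have hx1 : 1 ≤ x := by linarith
  have hd0 : (0 : ℝ) < d := by exact_mod_cast hd1
  have hmono := xs_mono hX0 h0 hrec
  have hpos := xs_pos hX0 h0 hrec
  set N : ℕ → ℕ := fun j => ⌊xs j⌋₊ with hN
  have hNmono : Monotone N := fun i j hij => Nat.floor_le_floor (hmono hij)
  have hNle : ∀ j, (N j : ℝ) ≤ xs j := fun j => Nat.floor_le (hpos j).le
  have hNgt : ∀ j, xs j < N j + 1 := fun j => Nat.lt_floor_add_one _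
  -- the indices `J` (`x_J ≤ x < x_{J+1}`) and `j₀` (first end-point `≥ x^{ν+ϖ}`)
  obtain ⟨J, hJ1, hJ2⟩ := exists_index hc.le hX0 h0 hrec hxX
  obtain ⟨j₀, hj₀1, hj₀2, -⟩ := exists_first_index hc.le hX0 h0 hrec (y := x ^ (ν + ϖ)) hxlow
  have hj₀J : j₀ ≤ J := by
    by_contra h
    have h1 : xs (J + 1) ≤ xs j₀ := hmono (by omega)
    linarith
  have hxJ : N J ≤ ⌊x⌋₊ := Nat.floor_le_floor hJ1
  have hxJ1 : ⌊x⌋₊ ≤ N (J + 1) := Nat.floor_le_floor hJ2.le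
  -- the range of (2.4) covers `d ≤ x^ν` on every interval `i ≥ j₀`
  have hνϖ0 : 0 < ν + ϖ := by linarith
  have hxνϖ : 0 < x ^ (ν + ϖ) := Real.rpow_pos_of_pos hx0 _
  have hdpow : ∀ i, j₀ ≤ i → (d : ℝ) ≤ xs i ^ (1 - ϖ) := by
    intro i hi
    have h1 : x ^ ν ≤ (x ^ (ν + ϖ)) ^ (1 - ϖ) := by
      rw [← Real.rpow_mul hx0.le]
      exact Real.rpow_le_rpow_of_exponent_le hx1 (by nlinarith)
    have h2 : (x ^ (ν + ϖ)) ^ (1 - ϖ) ≤ xs i ^ (1 - ϖ) :=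
      Real.rpow_le_rpow hxνϖ.le (hj₀1.trans (hmono hi)) (by linarith [hν0, hϖ1])
    linarith
  have hηi : ∀ i, j₀ ≤ i → Ford2004.eta c (xs i) ≤ Ford2004.eta c (x ^ (ν + ϖ)) := fun i hi =>
    Ford2004.eta_antitone hc.le hxνϖ (hj₀1.trans (hmono hi))
  have hη0 : 0 ≤ Ford2004.eta c (x ^ (ν + ϖ)) := (Ford2004.eta_pos _ _).le
  have hη0' : 0 ≤ Ford2004.eta (c * Real.sqrt (1 / 2)) x := (Ford2004.eta_pos _ _).le
  -- the summand with the divisibility indicator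
  set g : ℕ → ℝ := fun n => if d ∣ n then a n else 0 with hg
  have hg0 : ∀ n, 0 ≤ g n := fun n => by
    simp only [hg]
    split_ifs
    · exact (h02 n).1
    · exact le_rfl
  have hsumg : ∀ s : Finset ℕ, ∑ n ∈ s.filter (d ∣ ·), a n = ∑ n ∈ s, g n := fun s =>
    Finset.sum_filter _ _
  -- (2.4) on the blocks `i ≥ j₀`
  have hblock : ∀ i, j₀ ≤ i →
      |(∑ n ∈ Ioc (N i) (N (i + 1)), g n) - ((Ioc (N i) (N (i + 1))).card : ℝ) / d| ≤
        C * (((Ioc (N i) (N (i + 1))).card : ℝ) / d * Ford2004.eta c (xs i)) := by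
    intro i hi
    rw [← hsumg, Finset.sum_congr rfl fun n hn => ha i n (Finset.mem_filter.mp hn).1]
    exact h24 i d hd1 (hdpow i hi)
  -- decomposition of the sum and of `x/d`
  have hdec : ∑ n ∈ Ioc 0 ⌊x⌋₊, g n = ∑ n ∈ Ioc 0 (N j₀), g n
      + ∑ i ∈ Ico j₀ J, ∑ n ∈ Ioc (N i) (N (i + 1)), g n + ∑ n ∈ Ioc (N J) ⌊x⌋₊, g n := by
    rw [← sum_Ioc_eq_sum_blocks hNmono g hj₀J,
      Finset.sum_Ioc_consecutive g (Nat.zero_le _) hxJ]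
  have hNJ : (N J : ℝ) = N j₀ + ∑ i ∈ Ico j₀ J, ((Ioc (N i) (N (i + 1))).card : ℝ) :=
    cast_eq_sum_card_blocks hNmono hj₀J
  set S := ∑ i ∈ Ico j₀ J, ((Ioc (N i) (N (i + 1))).card : ℝ) with hS
  have hS0 : 0 ≤ S := Finset.sum_nonneg fun i _ => Nat.cast_nonneg _
  have hSx : S ≤ x := by
    have h1 : (0 : ℝ) ≤ N j₀ := Nat.cast_nonneg _
    linarith [hNle J]
  -- piece 1: the integers up to `N j₀ ≤ 2 x^{ν+ϖ}`, trivially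
  have hA1 : |(∑ n ∈ Ioc 0 (N j₀), g n) - (N j₀ : ℝ) / d| ≤ 4 * x ^ (ν + ϖ) / d := by
    have hup : ∑ n ∈ Ioc 0 (N j₀), g n ≤ 2 * (N j₀ : ℝ) / d := by
      rw [← hsumg]; exact sum_filter_dvd_le h02 _ _
    have hlo : 0 ≤ ∑ n ∈ Ioc 0 (N j₀), g n := Finset.sum_nonneg fun n _ => hg0 n
    have hN0 : (N j₀ : ℝ) ≤ 2 * x ^ (ν + ϖ) := (hNle j₀).trans hj₀2
    have hN0' : 0 ≤ (N j₀ : ℝ) / d := by positivity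
    have h4 : 2 * (N j₀ : ℝ) / d ≤ 4 * x ^ (ν + ϖ) / d :=
      div_le_div_of_nonneg_right (by linarith) hd0.le
    have h5 : (N j₀ : ℝ) / d ≤ 2 * (N j₀ : ℝ) / d :=
      div_le_div_of_nonneg_right (by linarith [Nat.cast_nonneg (α := ℝ) (N j₀)]) hd0.le
    rw [abs_sub_le_iff]
    constructor <;> linarith
  -- piece 2: the complete intervals, by (2.4)
  have hA2 : |(∑ i ∈ Ico j₀ J, ∑ n ∈ Ioc (N i) (N (i + 1)), g n) - S / d| ≤
      C * (x * Ford2004.eta c (x ^ (ν + ϖ))) / d := by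
    rw [hS, Finset.sum_div, ← Finset.sum_sub_distrib]
    refine (Finset.abs_sum_le_sum_abs _ _).trans ?_
    calc ∑ i ∈ Ico j₀ J, |(∑ n ∈ Ioc (N i) (N (i + 1)), g n)
            - ((Ioc (N i) (N (i + 1))).card : ℝ) / d|
        ≤ ∑ i ∈ Ico j₀ J, C * (((Ioc (N i) (N (i + 1))).card : ℝ) / d
            * Ford2004.eta c (x ^ (ν + ϖ))) := by
          refine Finset.sum_le_sum fun i hi => ?_
          have hi' : j₀ ≤ i := (Finset.mem_Ico.mp hi).1
          refine (hblock i hi').trans ?_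
          exact mul_le_mul_of_nonneg_left
            (mul_le_mul_of_nonneg_left (hηi i hi') (by positivity)) hC
      _ = C * Ford2004.eta c (x ^ (ν + ϖ)) / d * S := by
          rw [hS, Finset.mul_sum]
          exact Finset.sum_congr rfl fun i _ => by ring
      _ ≤ C * Ford2004.eta c (x ^ (ν + ϖ)) / d * x :=
          mul_le_mul_of_nonneg_left hSx (by positivity)
      _ = C * (x * Ford2004.eta c (x ^ (ν + ϖ))) / d := by ring
  -- piece 3: the incomplete last interval, `0 ≤ · ≤` the complete one
  have hsqJ : Real.sqrt x ≤ xs J := by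
    have h5 : x < 2 * xs J := by linarith [xs_succ_le hc.le hX0 h0 hrec J]
    linarith [sqrt_le_half hx4]
  have hKη : xs J * Ford2004.eta c (xs J) ≤ x * Ford2004.eta (c * Real.sqrt (1 / 2)) x :=
    mul_le_mul hJ1 (eta_le_eta_half hc.le hx0 hsqJ) (Ford2004.eta_pos _ _).le hx0.le
  have hK : ((Ioc (N J) (N (J + 1))).card : ℝ) ≤ x * Ford2004.eta (c * Real.sqrt (1 / 2)) x + 1 := by
    rw [Nat.card_Ioc, Nat.cast_sub (hNmono (Nat.le_succ J))]
    have h1 : (N (J + 1) : ℝ) ≤ xs (J + 1) := hNle (J + 1)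
    have h2 : xs J < N J + 1 := hNgt J
    have h3 : xs (J + 1) = xs J + xs J * Ford2004.eta c (xs J) := hrec J
    linarith
  have hA3 : |(∑ n ∈ Ioc (N J) ⌊x⌋₊, g n) - (x - N J) / d| ≤
      (1 + C) * (x * Ford2004.eta (c * Real.sqrt (1 / 2)) x + 1) / d := by
    set K := ((Ioc (N J) (N (J + 1))).card : ℝ) with hKdef
    set T := ∑ n ∈ Ioc (N J) ⌊x⌋₊, g n with hT
    have hT0 : 0 ≤ T := Finset.sum_nonneg fun n _ => hg0 n
    have hT1 : T ≤ ∑ n ∈ Ioc (N J) (N (J + 1)), g n :=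
      Finset.sum_le_sum_of_subset_of_nonneg (Finset.Ioc_subset_Ioc_right hxJ1)
        fun n _ _ => hg0 n
    have hT2 : ∑ n ∈ Ioc (N J) (N (J + 1)), g n ≤ K / d * (1 + C) := by
      have h := hblock J hj₀J
      rw [abs_sub_le_iff] at h
      have hη1 : Ford2004.eta c (xs J) ≤ 1 := Ford2004.eta_le_one hc.le _
      have hKd : 0 ≤ K / d := by positivity
      calc ∑ n ∈ Ioc (N J) (N (J + 1)), g n ≤ K / d + C * (K / d * Ford2004.eta c (xs J)) := by
            linarith [h.1]
        _ ≤ K / d + C * (K / d * 1) := by gcongr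
        _ = K / d * (1 + C) := by ring
    have hT3 : K / d * (1 + C) ≤ (1 + C) * (x * Ford2004.eta (c * Real.sqrt (1 / 2)) x + 1) / d := by
      rw [div_mul_eq_mul_div, mul_comm K]
      exact div_le_div_of_nonneg_right (mul_le_mul_of_nonneg_left hK (by linarith)) hd0.le
    have ht0 : 0 ≤ (x - N J) / d := div_nonneg (by linarith [hNle J]) hd0.le
    have ht1 : (x - N J) / d ≤ (1 + C) * (x * Ford2004.eta (c * Real.sqrt (1 / 2)) x + 1) / d := by
      refine div_le_div_of_nonneg_right ?_ hd0.le
      have h2 : xs J < N J + 1 := hNgt J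
      have h3 : xs (J + 1) = xs J + xs J * Ford2004.eta c (xs J) := hrec J
      have h6 : x - N J ≤ x * Ford2004.eta (c * Real.sqrt (1 / 2)) x + 1 := by linarith
      have h7 : 0 ≤ x * Ford2004.eta (c * Real.sqrt (1 / 2)) x + 1 := by positivity
      nlinarith
    rw [abs_sub_le_iff]
    constructor <;> linarith
  -- assemble
  rw [hsumg, hdec]
  have hxd : x / d = (N j₀ : ℝ) / d + S / d + (x - N J) / d := by
    rw [← add_div, ← add_div]
    congr 1
    linarith [hNJ]
  rw [hxd]
  have hsplit : (∑ n ∈ Ioc 0 (N j₀), g n) + (∑ i ∈ Ico j₀ J, ∑ n ∈ Ioc (N i) (N (i + 1)), g n)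
      + (∑ n ∈ Ioc (N J) ⌊x⌋₊, g n) - ((N j₀ : ℝ) / d + S / d + (x - N J) / d)
      = ((∑ n ∈ Ioc 0 (N j₀), g n) - (N j₀ : ℝ) / d)
        + ((∑ i ∈ Ico j₀ J, ∑ n ∈ Ioc (N i) (N (i + 1)), g n) - S / d)
        + ((∑ n ∈ Ioc (N J) ⌊x⌋₊, g n) - (x - N J) / d) := by ring
  rw [hsplit]
  refine (abs_add_three _ _ _).trans ?_
  refine (add_le_add (add_le_add hA1 hA2) hA3).trans (le_of_eq ?_)
  ring

/-- **`R(ν)` for the glued sequence** ([Ford2004] §2, p. 5: "Summing on `d` gives `R(ν)`"):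
`∑_{d ≤ x^ν} |A_d(x) − x/d| ≤ E(x)(1 + log x) ≪_B x (log x)^{−B}` for every `B`.
[cite: Ford2004, §2 p. 5 (deduction of R(ν) from (2.3)–(2.4))] -/
theorem typeI_isBigO
    (hν0 : 0 < ν) (hν1 : ν < 1) (hϖ0 : 0 < ϖ) (hϖ1 : ϖ < 1 - ν) (hc : 0 < c) (hC : 0 ≤ C)
    (hX : 2 ≤ X₀)
    (h0 : xs 0 = X₀) (hrec : ∀ j, xs (j + 1) = xs j + xs j * Ford2004.eta c (xs j))
    (h02 : ∀ n, 0 ≤ a n ∧ a n ≤ 2)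
    (ha : ∀ j, ∀ n ∈ Ioc ⌊xs j⌋₊ ⌊xs (j + 1)⌋₊, a n = aloc j n)
    (h24 : ∀ j (d : ℕ), 1 ≤ d → (d : ℝ) ≤ xs j ^ (1 - ϖ) →
      |(∑ n ∈ (Ioc ⌊xs j⌋₊ ⌊xs (j + 1)⌋₊).filter (d ∣ ·), aloc j n)
          - ((Ioc ⌊xs j⌋₊ ⌊xs (j + 1)⌋₊).card : ℝ) / d|
        ≤ C * (((Ioc ⌊xs j⌋₊ ⌊xs (j + 1)⌋₊).card : ℝ) / d * Ford2004.eta c (xs j)))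
    (B : ℝ) :
    (fun x : ℝ => ∑ d ∈ Icc 1 ⌊x ^ ν⌋₊, |(∑ n ∈ (Ioc 0 ⌊x⌋₊).filter (d ∣ ·), a n) - x / d|)
      =O[atTop] fun x : ℝ => x / Real.log x ^ B := by
  have hX0 : 0 < X₀ := by linarith
  have hνϖ0 : 0 < ν + ϖ := by linarith
  have hνϖ1 : ν + ϖ < 1 := by linarith
  have hc2 : 0 < c * Real.sqrt (ν + ϖ) := mul_pos hc (Real.sqrt_pos.mpr hνϖ0)
  have hc3 : 0 < c * Real.sqrt (1 / 2) := mul_pos hc (Real.sqrt_pos.mpr (by norm_num))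
  refine IsBigO.of_bound 4 ?_
  filter_upwards [eventually_ge_atTop (max X₀ 4),
    (tendsto_rpow_atTop hνϖ0).eventually_ge_atTop X₀,
    eventually_rpow_absorb hνϖ1 0 2, eventually_rpow_absorb hνϖ1 B 4,
    eventually_eta_absorb hc2 B C, eventually_eta_absorb hc3 B (1 + C),
    eventually_const_absorb B (1 + C)] with x hx hxpow hx2 hE1 hE2 hE3 hE4
  have hxX : X₀ ≤ x := le_trans (le_max_left _ _) hx
  have hx4 : 4 ≤ x := le_trans (le_max_right _ _) hx
  have hx0 : 0 < x := by linarith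
  have hx1 : 1 < x := by linarith
  have hL0 : 0 < Real.log x := Real.log_pos hx1
  have hxν : 0 ≤ x ^ ν := Real.rpow_nonneg hx0.le ν
  have hxνϖ : 0 ≤ x ^ (ν + ϖ) := Real.rpow_nonneg hx0.le _
  have hxlow : X₀ ≤ 2 * x ^ (ν + ϖ) := by linarith
  have hxup : 2 * x ^ (ν + ϖ) ≤ x := by
    rw [Real.rpow_zero, div_one] at hx2
    have h1 : 2 * x ^ (ν + ϖ) ≤ 2 * x ^ (ν + ϖ) * (1 + Real.log x) :=
      le_mul_of_one_le_right (by positivity) (by linarith)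
    linarith
  have hη0 : 0 ≤ Ford2004.eta c (x ^ (ν + ϖ)) := (Ford2004.eta_pos _ _).le
  have hη0' : 0 ≤ Ford2004.eta (c * Real.sqrt (1 / 2)) x := (Ford2004.eta_pos _ _).le
  set E := 4 * x ^ (ν + ϖ) + C * (x * Ford2004.eta c (x ^ (ν + ϖ)))
    + (1 + C) * (x * Ford2004.eta (c * Real.sqrt (1 / 2)) x + 1) with hE
  have hE0 : 0 ≤ E := by positivity
  have hlogfloor : Real.log (⌊x ^ ν⌋₊ : ℝ) ≤ Real.log x := by
    rcases Nat.eq_zero_or_pos ⌊x ^ ν⌋₊ with h | h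
    · rw [h, Nat.cast_zero, Real.log_zero]
      exact hL0.le
    · refine Real.log_le_log (by exact_mod_cast h) ?_
      calc (⌊x ^ ν⌋₊ : ℝ) ≤ x ^ ν := Nat.floor_le hxν
        _ ≤ x ^ (1 : ℝ) := Real.rpow_le_rpow_of_exponent_le hx1.le hν1.le
        _ = x := Real.rpow_one x
  have hsum : ∑ d ∈ Icc 1 ⌊x ^ ν⌋₊, |(∑ n ∈ (Ioc 0 ⌊x⌋₊).filter (d ∣ ·), a n) - x / d|
      ≤ E * (1 + Real.log x) := by
    calc ∑ d ∈ Icc 1 ⌊x ^ ν⌋₊, |(∑ n ∈ (Ioc 0 ⌊x⌋₊).filter (d ∣ ·), a n) - x / d|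
        ≤ ∑ d ∈ Icc 1 ⌊x ^ ν⌋₊, E / d := by
          refine Finset.sum_le_sum fun d hd => ?_
          have hd' := Finset.mem_Icc.mp hd
          refine typeI_pointwise hν0 hϖ0 hϖ1 hc hC hX h0 hrec h02 ha h24 hxX hx4 hxlow hxup hd'.1 ?_
          calc (d : ℝ) ≤ ⌊x ^ ν⌋₊ := by exact_mod_cast hd'.2
            _ ≤ x ^ ν := Nat.floor_le hxν
      _ = E * ∑ d ∈ Icc 1 ⌊x ^ ν⌋₊, (1 : ℝ) / d := by
          rw [Finset.mul_sum]
          exact Finset.sum_congr rfl fun d _ => by ring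
      _ ≤ E * (1 + Real.log ⌊x ^ ν⌋₊) := mul_le_mul_of_nonneg_left (sum_Icc_one_div_le _) hE0
      _ ≤ E * (1 + Real.log x) := mul_le_mul_of_nonneg_left (by linarith) hE0
  rw [Real.norm_of_nonneg (Finset.sum_nonneg fun d _ => abs_nonneg _),
    Real.norm_of_nonneg (by positivity : 0 ≤ x / Real.log x ^ B)]
  refine hsum.trans ?_
  have hη1 : Ford2004.eta c (x ^ (ν + ϖ)) = Ford2004.eta (c * Real.sqrt (ν + ϖ)) x :=
    eta_rpow hνϖ0.le hx0
  have hEexp : E * (1 + Real.log x) = 4 * x ^ (ν + ϖ) * (1 + Real.log x)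
      + C * (x * Ford2004.eta (c * Real.sqrt (ν + ϖ)) x) * (1 + Real.log x)
      + (1 + C) * (x * Ford2004.eta (c * Real.sqrt (1 / 2)) x) * (1 + Real.log x)
      + (1 + C) * (1 + Real.log x) := by
    rw [hE, hη1]; ring
  rw [hEexp]
  linarith

end TypeI

/-! ## Failure of `(S_k)` ([Ford2004] §2, p. 5) -/

section Sk

variable {c X₀ : ℝ} {xs : ℕ → ℝ} {aloc : ℕ → ℕ → ℝ} {a : ℕ → ℝ}

/-- `|(a_n − 1) Λ_k(n)| ≤ (log X)^k` for `0 ≤ a_n ≤ 2`, `1 ≤ n ≤ X`, `k ≥ 1` (`0 ≤ Λ_k(n) ≤ (log n)^k`,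
tree lemmas `generalizedVonMangoldt_nonneg`, `generalizedVonMangoldt_le`). [folklore] -/
theorem abs_pert_mul_le (h02 : ∀ n, 0 ≤ a n ∧ a n ≤ 2) {k : ℕ} (hk : 0 < k) {n : ℕ} (hn : 1 ≤ n)
    {X : ℝ} (hnX : (n : ℝ) ≤ X) :
    |(a n - 1) * generalizedVonMangoldt k n| ≤ Real.log X ^ k := by
  have hn0 : (0 : ℝ) < n := by exact_mod_cast hn
  have hlogn : 0 ≤ Real.log n := Real.log_nonneg (by exact_mod_cast hn)
  rw [abs_mul, abs_of_nonneg (generalizedVonMangoldt_nonneg k n)]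
  have h1 : |a n - 1| ≤ 1 := by
    rw [abs_le]
    constructor <;> linarith [(h02 n).1, (h02 n).2]
  calc |a n - 1| * generalizedVonMangoldt k n ≤ 1 * Real.log n ^ k :=
        mul_le_mul h1 (generalizedVonMangoldt_le hk n) (generalizedVonMangoldt_nonneg k n) zero_le_one
    _ = Real.log n ^ k := one_mul _
    _ ≤ Real.log X ^ k := pow_le_pow_left₀ hlogn (Real.log_le_log hn0 hnX) k

-- The 2026-08-14 full build timed out on this declaration at `whnf` with the default 200000
-- heartbeats after dependency drift, while the per-file check still passes; give it headroom.
set_option maxHeartbeats 400000 in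
/-- **Lower bound for the perturbation, one `x`** ([Ford2004] §2, p. 5, last display): with `y`
a cut-off (`x/(log x)^3` in the sequel), the intervals below `y` and the incomplete last interval
are bounded trivially by `Λ_k(n) ≤ (log n)^k`, and (2.5) is summed over the complete intervals
between `y` and `x`. [cite: Ford2004, §2 p. 5 (deduction of Theorem 1 from (2.3)–(2.5))] -/
theorem perturbation_lower_pointwise
    (hc : 0 < c) (hX : 2 ≤ X₀)
    (h0 : xs 0 = X₀) (hrec : ∀ j, xs (j + 1) = xs j + xs j * Ford2004.eta c (xs j))
    (h02 : ∀ n, 0 ≤ a n ∧ a n ≤ 2)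
    (ha : ∀ j, ∀ n ∈ Ioc ⌊xs j⌋₊ ⌊xs (j + 1)⌋₊, a n = aloc j n)
    {m : ℕ} {θ Ck xk : ℝ} (hθ : 0 ≤ θ) (hCk : 0 ≤ Ck)
    (h25 : ∀ j, xk ≤ xs j →
      |(∑ n ∈ Ioc ⌊xs j⌋₊ ⌊xs (j + 1)⌋₊, (aloc j n - 1) * generalizedVonMangoldt (m + 1) n)
          - θ * ((Ioc ⌊xs j⌋₊ ⌊xs (j + 1)⌋₊).card : ℝ) * Real.log (xs j) ^ m|
        ≤ Ck * ((Ioc ⌊xs j⌋₊ ⌊xs (j + 1)⌋₊).card : ℝ) * Real.log (xs j) ^ m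
          * Ford2004.eta c (xs j))
    {x y : ℝ} (hxX : X₀ ≤ x) (hx4 : 4 ≤ x) (hy2 : 2 ≤ y) (hylow : X₀ ≤ 2 * y) (hyk : xk ≤ y)
    (hyup : 2 * y ≤ x) (hysqrt : Real.sqrt x ≤ y) :
    θ * Real.log y ^ m * (x - x * Ford2004.eta (c * Real.sqrt (1 / 2)) x - 1 - 2 * y)
      - Ck * Ford2004.eta (c * Real.sqrt (1 / 2)) x * (x * Real.log x ^ m)
      - 2 * y * Real.log x ^ (m + 1)
      - (x * Ford2004.eta (c * Real.sqrt (1 / 2)) x + 1) * Real.log (2 * x) ^ (m + 1)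
      ≤ ∑ n ∈ Ioc 0 ⌊x⌋₊, (a n - 1) * generalizedVonMangoldt (m + 1) n := by
  -- basic facts
  have hX0 : 0 < X₀ := by linarith
  have hx0 : 0 < x := by linarith
  have hy0 : 0 < y := by linarith
  have hmono := xs_mono hX0 h0 hrec
  have hpos := xs_pos hX0 h0 hrec
  set N : ℕ → ℕ := fun j => ⌊xs j⌋₊ with hN
  have hNmono : Monotone N := fun i j hij => Nat.floor_le_floor (hmono hij)
  have hNle : ∀ j, (N j : ℝ) ≤ xs j := fun j => Nat.floor_le (hpos j).le
  have hNgt : ∀ j, xs j < N j + 1 := fun j => Nat.lt_floor_add_one _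
  set η' := Ford2004.eta (c * Real.sqrt (1 / 2)) x with hη'
  have hη'0 : 0 ≤ η' := (Ford2004.eta_pos _ _).le
  have hL0 : 0 < Real.log x := Real.log_pos (by linarith)
  have hLy0 : 0 ≤ Real.log y := Real.log_nonneg (by linarith)
  have hLyx : Real.log y ≤ Real.log x := Real.log_le_log hy0 (by linarith)
  -- indices
  obtain ⟨J, hJ1, hJ2⟩ := exists_index hc.le hX0 h0 hrec hxX
  obtain ⟨j₁, hj₁1, hj₁2, -⟩ := exists_first_index hc.le hX0 h0 hrec hylow
  have hj₁J : j₁ ≤ J := by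
    by_contra h
    have h1 : xs (J + 1) ≤ xs j₁ := hmono (by omega)
    linarith
  have hxJ : N J ≤ ⌊x⌋₊ := Nat.floor_le_floor hJ1
  have hxJ1 : ⌊x⌋₊ ≤ N (J + 1) := Nat.floor_le_floor hJ2.le
  -- the last interval
  have hsqJ : Real.sqrt x ≤ xs J := by
    have h5 : x < 2 * xs J := by linarith [xs_succ_le hc.le hX0 h0 hrec J]
    linarith [sqrt_le_half hx4]
  have hKη : xs J * Ford2004.eta c (xs J) ≤ x * η' :=
    mul_le_mul hJ1 (eta_le_eta_half hc.le hx0 hsqJ) (Ford2004.eta_pos _ _).le hx0.le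
  have hK : ((Ioc (N J) (N (J + 1))).card : ℝ) ≤ x * η' + 1 := by
    rw [Nat.card_Ioc, Nat.cast_sub (hNmono (Nat.le_succ J))]
    have h1 : (N (J + 1) : ℝ) ≤ xs (J + 1) := hNle (J + 1)
    have h2 : xs J < N J + 1 := hNgt J
    have h3 : xs (J + 1) = xs J + xs J * Ford2004.eta c (xs J) := hrec J
    linarith
  -- the summand
  set f : ℕ → ℝ := fun n => (a n - 1) * generalizedVonMangoldt (m + 1) n with hf
  -- decomposition
  have hdec : ∑ n ∈ Ioc 0 ⌊x⌋₊, f n = ∑ n ∈ Ioc 0 (N j₁), f n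
      + ∑ i ∈ Ico j₁ J, ∑ n ∈ Ioc (N i) (N (i + 1)), f n + ∑ n ∈ Ioc (N J) ⌊x⌋₊, f n := by
    rw [← sum_Ioc_eq_sum_blocks hNmono f hj₁J,
      Finset.sum_Ioc_consecutive f (Nat.zero_le _) hxJ]
  set S := ∑ i ∈ Ico j₁ J, ((Ioc (N i) (N (i + 1))).card : ℝ) with hS
  have hNJ : (N J : ℝ) = N j₁ + S := cast_eq_sum_card_blocks hNmono hj₁J
  have hS0 : 0 ≤ S := Finset.sum_nonneg fun i _ => Nat.cast_nonneg _
  have hSx : S ≤ x := by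
    have h1 : (0 : ℝ) ≤ N j₁ := Nat.cast_nonneg _
    linarith [hNle J]
  have hSlow : x - x * η' - 1 - 2 * y ≤ S := by
    have h2 : xs J < N J + 1 := hNgt J
    have h3 : xs (J + 1) = xs J + xs J * Ford2004.eta c (xs J) := hrec J
    have h4 : (N j₁ : ℝ) ≤ 2 * y := (hNle j₁).trans hj₁2
    linarith
  -- piece 1: `n ≤ N j₁ ≤ 2y`
  have hP1 : -(2 * y * Real.log x ^ (m + 1)) ≤ ∑ n ∈ Ioc 0 (N j₁), f n := by
    have h1 : ∀ n ∈ Ioc 0 (N j₁), -(Real.log x ^ (m + 1)) ≤ f n := by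
      intro n hn
      rw [Finset.mem_Ioc] at hn
      have hnx : (n : ℝ) ≤ x := by
        have : (n : ℝ) ≤ N j₁ := by exact_mod_cast hn.2
        linarith [hNle j₁]
      have := abs_pert_mul_le h02 (Nat.succ_pos m) hn.1 hnx
      rw [abs_le] at this
      exact this.1
    have h2 := Finset.sum_le_sum h1
    rw [Finset.sum_const, Nat.card_Ioc, Nat.sub_zero, nsmul_eq_mul] at h2
    refine le_trans ?_ h2
    have h3 : (N j₁ : ℝ) ≤ 2 * y := (hNle j₁).trans hj₁2
    have h4 : 0 ≤ Real.log x ^ (m + 1) := pow_nonneg hL0.le _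
    nlinarith
  -- piece 2: the complete intervals between `y` and `x`, by (2.5)
  have hP2 : θ * Real.log y ^ m * (x - x * η' - 1 - 2 * y) - Ck * η' * (x * Real.log x ^ m)
      ≤ ∑ i ∈ Ico j₁ J, ∑ n ∈ Ioc (N i) (N (i + 1)), f n := by
    have hper : ∀ i ∈ Ico j₁ J,
        (θ * Real.log y ^ m - Ck * Real.log x ^ m * η') * ((Ioc (N i) (N (i + 1))).card : ℝ)
          ≤ ∑ n ∈ Ioc (N i) (N (i + 1)), f n := by
      intro i hi
      rw [Finset.mem_Ico] at hi
      have hyi : y ≤ xs i := hj₁1.trans (hmono hi.1)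
      have hix : xs i ≤ x := (hmono (Nat.le_of_lt_succ (Nat.lt_succ_of_lt hi.2))).trans hJ1
      have hLi0 : 0 ≤ Real.log (xs i) := Real.log_nonneg (by linarith)
      have hLyi : Real.log y ≤ Real.log (xs i) := Real.log_le_log hy0 hyi
      have hLix : Real.log (xs i) ≤ Real.log x := Real.log_le_log (hpos i) hix
      have hηi : Ford2004.eta c (xs i) ≤ η' := eta_le_eta_half hc.le hx0 (hysqrt.trans hyi)
      have hηi0 : 0 ≤ Ford2004.eta c (xs i) := (Ford2004.eta_pos _ _).le
      set K := ((Ioc (N i) (N (i + 1))).card : ℝ) with hK'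
      have hK0 : 0 ≤ K := Nat.cast_nonneg _
      have h := h25 i (hyk.trans hyi)
      rw [Finset.sum_congr rfl fun n hn => show f n = (aloc i n - 1) * generalizedVonMangoldt (m + 1) n
        by simp only [hf, ha i n hn]]
      rw [abs_sub_le_iff] at h
      have hlow : θ * K * Real.log (xs i) ^ m - Ck * K * Real.log (xs i) ^ m * Ford2004.eta c (xs i)
          ≤ ∑ n ∈ Ioc (N i) (N (i + 1)), (aloc i n - 1) * generalizedVonMangoldt (m + 1) n := by
        linarith [h.2]
      refine le_trans ?_ hlow
      have h1 : θ * K * Real.log y ^ m ≤ θ * K * Real.log (xs i) ^ m :=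
        mul_le_mul_of_nonneg_left (pow_le_pow_left₀ hLy0 hLyi m) (mul_nonneg hθ hK0)
      have h2 : Ck * K * Real.log (xs i) ^ m * Ford2004.eta c (xs i)
          ≤ Ck * K * Real.log x ^ m * η' :=
        mul_le_mul (mul_le_mul_of_nonneg_left (pow_le_pow_left₀ hLi0 hLix m)
          (mul_nonneg hCk hK0)) hηi hηi0 (by positivity)
      nlinarith
    have hsum := Finset.sum_le_sum hper
    rw [← Finset.mul_sum] at hsum
    refine le_trans ?_ hsum
    rw [← hS]
    have h1 : θ * Real.log y ^ m * (x - x * η' - 1 - 2 * y) ≤ θ * Real.log y ^ m * S :=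
      mul_le_mul_of_nonneg_left hSlow (mul_nonneg hθ (pow_nonneg hLy0 m))
    have h2 : Ck * Real.log x ^ m * η' * S ≤ Ck * η' * (x * Real.log x ^ m) := by
      have : Ck * Real.log x ^ m * η' * S ≤ Ck * Real.log x ^ m * η' * x :=
        mul_le_mul_of_nonneg_left hSx (by positivity)
      linarith
    nlinarith
  -- piece 3: the incomplete last interval
  have hP3 : -((x * η' + 1) * Real.log (2 * x) ^ (m + 1)) ≤ ∑ n ∈ Ioc (N J) ⌊x⌋₊, f n := by
    have h1 : ∀ n ∈ Ioc (N J) (N (J + 1)), |f n| ≤ Real.log (2 * x) ^ (m + 1) := by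
      intro n hn
      rw [Finset.mem_Ioc] at hn
      have hn1 : 1 ≤ n := by omega
      have hnx : (n : ℝ) ≤ 2 * x := by
        have h6 : (n : ℝ) ≤ N (J + 1) := by exact_mod_cast hn.2
        linarith [hNle (J + 1), xs_succ_le hc.le hX0 h0 hrec J]
      exact abs_pert_mul_le h02 (Nat.succ_pos m) hn1 hnx
    -- `|∑_{(N J, ⌊x⌋]} f| ≤ ∑_{(N J, N(J+1)]} |f| ≤ K (log 2x)^{m+1}`
    have h2 : |∑ n ∈ Ioc (N J) ⌊x⌋₊, f n| ≤ ∑ n ∈ Ioc (N J) (N (J + 1)), |f n| :=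
      (Finset.abs_sum_le_sum_abs _ _).trans
        (Finset.sum_le_sum_of_subset_of_nonneg (Finset.Ioc_subset_Ioc_right hxJ1)
          fun n _ _ => abs_nonneg _)
    have h3 := Finset.sum_le_sum h1
    rw [Finset.sum_const, nsmul_eq_mul] at h3
    have h4 : ((Ioc (N J) (N (J + 1))).card : ℝ) * Real.log (2 * x) ^ (m + 1)
        ≤ (x * η' + 1) * Real.log (2 * x) ^ (m + 1) :=
      mul_le_mul_of_nonneg_right hK (pow_nonneg (Real.log_nonneg (by linarith)) _)
    have h5 := (abs_le.mp (h2.trans (h3.trans h4))).1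
    exact h5
  rw [hdec]
  linarith

/-- `log(2x)^{m+1} ≤ 2^{m+1} (log x)^{m+1}` for `x ≥ 2`. [folklore] -/
theorem log_two_mul_pow_le {x : ℝ} (hx : 2 ≤ x) (m : ℕ) :
    Real.log (2 * x) ^ (m + 1) ≤ 2 ^ (m + 1) * Real.log x ^ (m + 1) := by
  have hl2 : Real.log 2 ≤ Real.log x := Real.log_le_log two_pos hx
  have hL : Real.log (2 * x) ≤ 2 * Real.log x := by
    rw [Real.log_mul two_ne_zero (by linarith)]
    linarith
  have hL0 : 0 ≤ Real.log (2 * x) := Real.log_nonneg (by linarith)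
  calc Real.log (2 * x) ^ (m + 1) ≤ (2 * Real.log x) ^ (m + 1) := pow_le_pow_left₀ hL0 hL _
    _ = 2 ^ (m + 1) * Real.log x ^ (m + 1) := mul_pow _ _ _

/-- `log y / log x → 1` for `y = x/(log x)^3`, in the form: eventually
`(1 − δ) (log x)^m ≤ (log (x/(log x)^3))^m`. [folklore] -/
theorem eventually_log_cutoff_pow_ge {δ : ℝ} (hδ : 0 < δ) (m : ℕ) :
    ∀ᶠ x : ℝ in atTop, (1 - δ) * Real.log x ^ m ≤ Real.log (x / Real.log x ^ 3) ^ m := by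
  -- `log(log x)/log x → 0`
  have h1 : Tendsto (fun u : ℝ => Real.log u / u) atTop (𝓝 0) := by
    have := Real.tendsto_pow_log_div_mul_add_atTop 1 0 1 one_ne_zero
    simpa using this
  have h2 : Tendsto (fun x : ℝ => Real.log (Real.log x) / Real.log x) atTop (𝓝 0) :=
    h1.comp Real.tendsto_log_atTop
  have h3 : Tendsto (fun x : ℝ => (1 - 3 * (Real.log (Real.log x) / Real.log x)) ^ m) atTop
      (𝓝 ((1 - 3 * 0) ^ m)) := ((h2.const_mul 3).const_sub 1).pow m
  rw [mul_zero, sub_zero, one_pow] at h3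
  have h4 : ∀ᶠ x : ℝ in atTop, 1 - δ < (1 - 3 * (Real.log (Real.log x) / Real.log x)) ^ m :=
    (tendsto_order.1 h3).1 _ (by linarith)
  filter_upwards [h4, eventually_gt_atTop (1 : ℝ),
    Real.tendsto_log_atTop.eventually_gt_atTop (1 : ℝ)] with x hx hx1 hL1
  have hx0 : 0 < x := by linarith
  have hL0 : 0 < Real.log x := by linarith
  have hlogy : Real.log (x / Real.log x ^ 3) =
      (1 - 3 * (Real.log (Real.log x) / Real.log x)) * Real.log x := by
    rw [Real.log_div hx0.ne' (by positivity), Real.log_pow]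
    field_simp
    ring
  rw [hlogy, mul_pow]
  exact mul_le_mul_of_nonneg_right hx.le (pow_nonneg hL0.le m)

/-- **The perturbation is eventually large**: for the glued sequence, eventually
`∑_{n ≤ x} (a_n − 1) Λ_{m+1}(n) ≥ (θ/2) x (log x)^m` ([Ford2004] §2, p. 5, last display, with
`σ_j = 1` for all `j`, i.e. case (ii) of Theorem 1). [cite: Ford2004, §2 p. 5 (deduction of Theorem 1, case (ii))] -/
theorem eventually_perturbation_ge
    (hc : 0 < c) (hX : 2 ≤ X₀)
    (h0 : xs 0 = X₀) (hrec : ∀ j, xs (j + 1) = xs j + xs j * Ford2004.eta c (xs j))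
    (h02 : ∀ n, 0 ≤ a n ∧ a n ≤ 2)
    (ha : ∀ j, ∀ n ∈ Ioc ⌊xs j⌋₊ ⌊xs (j + 1)⌋₊, a n = aloc j n)
    {m : ℕ} {θ Ck xk : ℝ} (hθ : 0 < θ) (hCk : 0 ≤ Ck)
    (h25 : ∀ j, xk ≤ xs j →
      |(∑ n ∈ Ioc ⌊xs j⌋₊ ⌊xs (j + 1)⌋₊, (aloc j n - 1) * generalizedVonMangoldt (m + 1) n)
          - θ * ((Ioc ⌊xs j⌋₊ ⌊xs (j + 1)⌋₊).card : ℝ) * Real.log (xs j) ^ m|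
        ≤ Ck * ((Ioc ⌊xs j⌋₊ ⌊xs (j + 1)⌋₊).card : ℝ) * Real.log (xs j) ^ m
          * Ford2004.eta c (xs j)) :
    ∀ᶠ x : ℝ in atTop,
      θ / 2 * (x * Real.log x ^ m) ≤ ∑ n ∈ Ioc 0 ⌊x⌋₊, (a n - 1) * generalizedVonMangoldt (m + 1) n := by
  have hX0 : 0 < X₀ := by linarith
  have hc3 : 0 < c * Real.sqrt (1 / 2) := mul_pos hc (Real.sqrt_pos.mpr (by norm_num))
  set δ : ℝ := 1 / 10 with hδ
  have hδ0 : (0 : ℝ) < δ := by norm_num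
  -- the smallness inputs
  obtain ⟨C', hC'0, hC'⟩ := eta_le_div_logPow hc3 2
  have hη := tendsto_eta hc3
  -- `y = x/(log x)^3 → ∞` in the form of the needed lower bounds: via `√x ≤ y`
  have hylarge : ∀ᶠ x : ℝ in atTop, Real.sqrt x ≤ x / Real.log x ^ 3 := by
    -- `(log x)^3 ≤ x^{1/2}` eventually
    have hlo := isLittleO_log_rpow_rpow_atTop (3 : ℝ) (show (0 : ℝ) < 1 / 2 by norm_num)
    filter_upwards [hlo.def zero_lt_one, eventually_gt_atTop (1 : ℝ)] with x hx hx1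
    have hx0 : 0 < x := by linarith
    have hL0 : 0 < Real.log x := Real.log_pos hx1
    rw [Real.norm_of_nonneg (Real.rpow_nonneg hL0.le _), Real.norm_of_nonneg (Real.rpow_nonneg hx0.le _),
      one_mul] at hx
    have hL3 : Real.log x ^ (3 : ℕ) ≤ Real.sqrt x := by
      rw [Real.sqrt_eq_rpow, ← Real.rpow_natCast]
      exact_mod_cast hx
    rw [le_div_iff₀ (pow_pos hL0 3)]
    calc Real.sqrt x * Real.log x ^ 3 ≤ Real.sqrt x * Real.sqrt x :=
          mul_le_mul_of_nonneg_left hL3 (Real.sqrt_nonneg x)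
      _ = x := Real.mul_self_sqrt hx0.le
  have hsqrt := Real.tendsto_sqrt_atTop
  have hε : (0 : ℝ) < min (1 / 30) (1 / 10 * θ / (Ck + 1)) := by positivity
  have hε' : (0 : ℝ) < 1 / 10 * θ / (20 * 2 ^ (m + 1)) := by positivity
  filter_upwards [eventually_ge_atTop (max X₀ 4), hylarge,
    hsqrt.eventually_ge_atTop (max 2 (max (X₀ / 2) xk)),
    Real.tendsto_log_atTop.eventually_ge_atTop
      (max 30 (max (20 / θ) (20 * 2 ^ (m + 1) * C' / θ))),
    hη.eventually (ge_mem_nhds hε), eventually_log_cutoff_pow_ge (show (0:ℝ) < 1 / 10 by norm_num) m,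
    tendsto_inv_atTop_zero.eventually (ge_mem_nhds (show (0:ℝ) < 1 / 30 by norm_num)),
    (Real.tendsto_pow_log_div_mul_add_atTop 1 0 1 one_ne_zero).eventually (ge_mem_nhds hε')]
    with x hx hyx hsx hLx hηx hlogy hinvx hlogdivx
  -- unpack the thresholds
  have hxX : X₀ ≤ x := le_trans (le_max_left _ _) hx
  have hx4 : 4 ≤ x := le_trans (le_max_right _ _) hx
  have hx0 : 0 < x := by linarith
  have hx2 : 2 ≤ x := by linarith
  have hs2 : 2 ≤ Real.sqrt x := le_trans (le_max_left _ _) hsx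
  have hsX : X₀ / 2 ≤ Real.sqrt x := le_trans (le_trans (le_max_left _ _) (le_max_right _ _)) hsx
  have hsk : xk ≤ Real.sqrt x := le_trans (le_trans (le_max_right _ _) (le_max_right _ _)) hsx
  have hL30 : 30 ≤ Real.log x := le_trans (le_max_left _ _) hLx
  have hLθ : 20 / θ ≤ Real.log x := le_trans (le_trans (le_max_left _ _) (le_max_right _ _)) hLx
  have hLC : 20 * 2 ^ (m + 1) * C' / θ ≤ Real.log x :=
    le_trans (le_trans (le_max_right _ _) (le_max_right _ _)) hLx
  have hL0 : 0 < Real.log x := by linarith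
  have hη1 : Ford2004.eta (c * Real.sqrt (1 / 2)) x ≤ 1 / 30 := le_trans hηx (min_le_left _ _)
  have hη2 : Ford2004.eta (c * Real.sqrt (1 / 2)) x ≤ 1 / 10 * θ / (Ck + 1) :=
    le_trans hηx (min_le_right _ _)
  have hη3 : Ford2004.eta (c * Real.sqrt (1 / 2)) x ≤ C' / Real.log x ^ (2 : ℝ) := hC' x hx2
  have hη0 : 0 ≤ Ford2004.eta (c * Real.sqrt (1 / 2)) x := (Ford2004.eta_pos _ _).le
  simp only [pow_one, one_mul, add_zero] at hlogdivx
  -- the cut-off `y = x/(log x)^3`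
  have hy2 : 2 ≤ x / Real.log x ^ 3 := hs2.trans hyx
  have hylow : X₀ ≤ 2 * (x / Real.log x ^ 3) := by linarith [hsX.trans hyx]
  have hyk : xk ≤ x / Real.log x ^ 3 := hsk.trans hyx
  have hL3 : 60 ≤ Real.log x ^ 3 := by nlinarith
  have hyup' : 2 * (x / Real.log x ^ 3) ≤ x / 30 := by
    rw [mul_div_assoc', div_le_div_iff₀ (by positivity) (by norm_num)]
    nlinarith
  have hyup : 2 * (x / Real.log x ^ 3) ≤ x := by linarith
  -- the pointwise lower bound
  have hLB := perturbation_lower_pointwise hc hX h0 hrec h02 ha hθ.le hCk h25 hxX hx4 hy2 hylow hyk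
    hyup hyx
  -- main term
  have hB : (1 - 1 / 10) * x ≤
      x - x * Ford2004.eta (c * Real.sqrt (1 / 2)) x - 1 - 2 * (x / Real.log x ^ 3) := by
    have h1 : x * Ford2004.eta (c * Real.sqrt (1 / 2)) x ≤ x * (1 / 30) :=
      mul_le_mul_of_nonneg_left hη1 hx0.le
    have h2 : 1 ≤ x * (1 / 30) := by
      have := mul_le_mul_of_nonneg_left hinvx hx0.le
      rwa [mul_inv_cancel₀ hx0.ne'] at this
    linarith
  have hmain : θ * (1 - 1 / 10) ^ 2 * (x * Real.log x ^ m) ≤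
      θ * Real.log (x / Real.log x ^ 3) ^ m
        * (x - x * Ford2004.eta (c * Real.sqrt (1 / 2)) x - 1 - 2 * (x / Real.log x ^ 3)) := by
    have hA0 : 0 ≤ (1 - 1 / 10) * Real.log x ^ m := by positivity
    have hB0 : 0 ≤ (1 - 1 / 10) * x := by positivity
    calc θ * (1 - 1 / 10) ^ 2 * (x * Real.log x ^ m)
        = θ * (((1 - 1 / 10) * Real.log x ^ m) * ((1 - 1 / 10) * x)) := by ring
      _ ≤ θ * (Real.log (x / Real.log x ^ 3) ^ m
          * (x - x * Ford2004.eta (c * Real.sqrt (1 / 2)) x - 1 - 2 * (x / Real.log x ^ 3))) :=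
          mul_le_mul_of_nonneg_left (mul_le_mul hlogy hB hB0 (hA0.trans hlogy)) hθ.le
      _ = _ := by ring
  -- error 1: `Ck η' x (log x)^m`
  have he1 : Ck * Ford2004.eta (c * Real.sqrt (1 / 2)) x * (x * Real.log x ^ m) ≤
      1 / 10 * θ * (x * Real.log x ^ m) := by
    refine mul_le_mul_of_nonneg_right ?_ (by positivity)
    have h1 : Ck / (Ck + 1) ≤ 1 := (div_le_one (by linarith)).mpr (by linarith)
    calc Ck * Ford2004.eta (c * Real.sqrt (1 / 2)) x ≤ Ck * (1 / 10 * θ / (Ck + 1)) :=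
          mul_le_mul_of_nonneg_left hη2 hCk
      _ = 1 / 10 * θ * (Ck / (Ck + 1)) := by ring
      _ ≤ 1 / 10 * θ * 1 := mul_le_mul_of_nonneg_left h1 (by positivity)
      _ = 1 / 10 * θ := mul_one _
  -- error 2: `2 y (log x)^{m+1} = 2 x (log x)^m / (log x)^2`
  have he2 : 2 * (x / Real.log x ^ 3) * Real.log x ^ (m + 1) ≤ 1 / 10 * θ * (x * Real.log x ^ m) := by
    have h1 : 2 * (x / Real.log x ^ 3) * Real.log x ^ (m + 1) =
        2 / Real.log x ^ 2 * (x * Real.log x ^ m) := by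
      field_simp
      ring
    rw [h1]
    refine mul_le_mul_of_nonneg_right ?_ (by positivity)
    rw [div_le_iff₀ (by positivity)]
    have h2 : 20 ≤ θ * Real.log x := by
      have := (div_le_iff₀ hθ).mp hLθ
      linarith
    have h3 : 20 * 30 ≤ θ * Real.log x * Real.log x :=
      mul_le_mul h2 hL30 (by norm_num) (by positivity)
    have h4 : 1 / 10 * θ * Real.log x ^ 2 = 1 / 10 * (θ * Real.log x * Real.log x) := by ring
    rw [h4]
    linarith
  -- error 3: the last interval, `(x η' + 1)(log 2x)^{m+1}`
  have he3 : (x * Ford2004.eta (c * Real.sqrt (1 / 2)) x + 1) * Real.log (2 * x) ^ (m + 1) ≤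
      1 / 10 * θ * (x * Real.log x ^ m) := by
    have h1 := log_two_mul_pow_le hx2 m
    have h2 : (x * Ford2004.eta (c * Real.sqrt (1 / 2)) x + 1) * Real.log (2 * x) ^ (m + 1) ≤
        (x * Ford2004.eta (c * Real.sqrt (1 / 2)) x + 1) * (2 ^ (m + 1) * Real.log x ^ (m + 1)) :=
      mul_le_mul_of_nonneg_left h1 (by positivity)
    refine h2.trans ?_
    -- (i) the `x η'` part
    have h3 : x * Ford2004.eta (c * Real.sqrt (1 / 2)) x * (2 ^ (m + 1) * Real.log x ^ (m + 1)) ≤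
        1 / 20 * θ * (x * Real.log x ^ m) := by
      have h4 : x * Ford2004.eta (c * Real.sqrt (1 / 2)) x * (2 ^ (m + 1) * Real.log x ^ (m + 1)) ≤
          x * (C' / Real.log x ^ (2 : ℝ)) * (2 ^ (m + 1) * Real.log x ^ (m + 1)) :=
        mul_le_mul_of_nonneg_right (mul_le_mul_of_nonneg_left hη3 hx0.le) (by positivity)
      refine h4.trans ?_
      have h5 : x * (C' / Real.log x ^ (2 : ℝ)) * (2 ^ (m + 1) * Real.log x ^ (m + 1)) =
          (2 ^ (m + 1) * C' / Real.log x) * (x * Real.log x ^ m) := by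
        rw [Real.rpow_two]
        field_simp
        ring
      rw [h5]
      refine mul_le_mul_of_nonneg_right ?_ (by positivity)
      rw [div_le_iff₀ hL0]
      have h9 := (div_le_iff₀ hθ).mp hLC
      -- h9 : 20 * 2 ^ (m + 1) * C' ≤ log x * θ
      linarith
    -- (ii) the `+1` part
    have h6 : 1 * (2 ^ (m + 1) * Real.log x ^ (m + 1)) ≤ 1 / 20 * θ * (x * Real.log x ^ m) := by
      have h7 : Real.log x ≤ 1 / 10 * θ / (20 * 2 ^ (m + 1)) * x := by
        rwa [div_le_iff₀ hx0] at hlogdivx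
      calc 1 * (2 ^ (m + 1) * Real.log x ^ (m + 1)) = 2 ^ (m + 1) * Real.log x * Real.log x ^ m := by
            ring
        _ ≤ 2 ^ (m + 1) * (1 / 10 * θ / (20 * 2 ^ (m + 1)) * x) * Real.log x ^ m := by
            gcongr
        _ = 1 / 200 * θ * (x * Real.log x ^ m) := by
            field_simp
            ring
        _ ≤ 1 / 20 * θ * (x * Real.log x ^ m) := by
            have h8 : 0 ≤ θ * (x * Real.log x ^ m) := by positivity
            linarith
    calc (x * Ford2004.eta (c * Real.sqrt (1 / 2)) x + 1) * (2 ^ (m + 1) * Real.log x ^ (m + 1))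
        = x * Ford2004.eta (c * Real.sqrt (1 / 2)) x * (2 ^ (m + 1) * Real.log x ^ (m + 1))
          + 1 * (2 ^ (m + 1) * Real.log x ^ (m + 1)) := by ring
      _ ≤ 1 / 20 * θ * (x * Real.log x ^ m) + 1 / 20 * θ * (x * Real.log x ^ m) := add_le_add h3 h6
      _ = 1 / 10 * θ * (x * Real.log x ^ m) := by ring
  have hθP : 0 ≤ θ * (x * Real.log x ^ m) := by positivity
  linarith

/-- **The unperturbed sums** (prime number theorem for `Λ_k`): for every `m`,
`∑_{n ≤ x} Λ_{m+1}(n) − (m+1) x (log x)^m = o(x (log x)^m)`; `m = 0` is the prime number theorem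
with the de la Vallée Poussin error term (tree: `ChebyshevPsiDeLaValleePoussin_holds`), `m ≥ 1`
is [FriedlanderIwaniecPisa1978] Lemma 3 (tree: `BombieriSieve.FI1978_lemma3_rat_explicit`). [folklore] -/
theorem isLittleO_sum_generalizedVonMangoldt_sub (m : ℕ) :
    (fun x : ℝ => (∑ n ∈ Ioc 0 ⌊x⌋₊, generalizedVonMangoldt (m + 1) n)
        - ((m + 1 : ℕ) : ℝ) * x * Real.log x ^ m)
      =o[atTop] fun x : ℝ => ((m + 1 : ℕ) : ℝ) * x * Real.log x ^ m := by
  rw [Asymptotics.isLittleO_iff]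
  intro ε hε
  rcases Nat.eq_zero_or_pos m with rfl | hm
  · -- `k = 1`: the prime number theorem
    obtain ⟨c, hc, C, hC⟩ := ChebyshevPsiDeLaValleePoussin_holds
    obtain ⟨C', hC'⟩ := logPow_of_expSqrt hc hC 1
    filter_upwards [eventually_ge_atTop (2 : ℝ),
      Real.tendsto_log_atTop.eventually_ge_atTop (max 1 (C' / ε))] with x hx hL
    have hx0 : 0 < x := by linarith
    have hL1 : 1 ≤ Real.log x := le_trans (le_max_left _ _) hL
    have hL0 : 0 < Real.log x := by linarith
    have h1 := hC' x hx
    rw [Real.rpow_one] at h1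
    simp only [Nat.zero_add, Nat.cast_one, one_mul, pow_zero, mul_one]
    rw [generalizedVonMangoldt_one, Real.norm_eq_abs, Real.norm_eq_abs, abs_of_pos hx0]
    change |Chebyshev.psi x - x| ≤ ε * x
    refine h1.trans ?_
    rw [div_le_iff₀ hL0]
    have h2 : C' ≤ ε * Real.log x := by
      have := le_trans (le_max_right _ _) hL
      rw [div_le_iff₀ hε] at this
      linarith
    nlinarith
  · -- `k ≥ 2`: [FriedlanderIwaniecPisa1978] Lemma 3
    obtain ⟨m', rfl⟩ : ∃ m', m = m' + 1 := ⟨m - 1, by omega⟩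
    obtain ⟨c, hc1, hc⟩ := BombieriSieve.FI1978_lemma3_rat_explicit
    have hc0 : 0 < c := by linarith
    filter_upwards [eventually_ge_atTop (max c 3),
      Real.tendsto_log_atTop.eventually_ge_atTop (max 1 (c ^ (m' + 2) * 2 ^ m' / ε))]
      with x hx hL
    have hxc : c ≤ x := le_trans (le_max_left _ _) hx
    have hx3 : 3 ≤ x := le_trans (le_max_right _ _) hx
    have hx0 : 0 < x := by linarith
    have hL1 : 1 ≤ Real.log x := le_trans (le_max_left _ _) hL
    have hL0 : 0 < Real.log x := by linarith
    have h1 := hc (m' + 2) (by omega) x (by linarith)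
    simp only [Nat.add_sub_cancel, show m' + 2 - 1 = m' + 1 from rfl] at h1
    have hlogc : Real.log (c * x) ≤ 2 * Real.log x := by
      rw [Real.log_mul hc0.ne' hx0.ne']
      linarith [Real.log_le_log hc0 hxc]
    have hlogc0 : 0 ≤ Real.log (c * x) := Real.log_nonneg (by nlinarith)
    have h2 : c ^ (m' + 2) * x * Real.log (c * x) ^ m' ≤
        c ^ (m' + 2) * x * (2 ^ m' * Real.log x ^ m') := by
      refine mul_le_mul_of_nonneg_left ?_ (by positivity)
      calc Real.log (c * x) ^ m' ≤ (2 * Real.log x) ^ m' := pow_le_pow_left₀ hlogc0 hlogc m'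
        _ = 2 ^ m' * Real.log x ^ m' := mul_pow _ _ _
    have hpos : 0 < (((m' + 1 + 1 : ℕ) : ℝ)) * x * Real.log x ^ (m' + 1) := by positivity
    rw [show m' + 1 + 1 = m' + 2 by ring] at hpos ⊢
    rw [Real.norm_eq_abs, Real.norm_eq_abs, abs_of_pos hpos]
    refine h1.trans (h2.trans ?_)
    have h3 : c ^ (m' + 2) * 2 ^ m' ≤ ε * Real.log x := by
      have := le_trans (le_max_right _ _) hL
      rw [div_le_iff₀ hε] at this
      linarith
    have h4 : (1 : ℝ) ≤ ((m' + 2 : ℕ) : ℝ) := by exact_mod_cast (by omega : 1 ≤ m' + 2)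
    calc c ^ (m' + 2) * x * (2 ^ m' * Real.log x ^ m')
        = (c ^ (m' + 2) * 2 ^ m') * (x * Real.log x ^ m') := by ring
      _ ≤ (ε * Real.log x) * (x * Real.log x ^ m') :=
          mul_le_mul_of_nonneg_right h3 (by positivity)
      _ = ε * (1 * x * Real.log x ^ (m' + 1)) := by ring
      _ ≤ ε * (((m' + 2 : ℕ) : ℝ) * x * Real.log x ^ (m' + 1)) := by
          refine mul_le_mul_of_nonneg_left ?_ hε.le
          exact mul_le_mul_of_nonneg_right (mul_le_mul_of_nonneg_right h4 hx0.le) (by positivity)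

/-- **`(S_k)` fails for the glued sequence** ([Ford2004] Theorem 1, case (ii): `T_k(x) → 1 + θ_k/k`).
If `∑_{n ≤ x} a_n Λ_k(n) ∼ k x (log x)^{k−1}` then, subtracting the unperturbed asymptotic,
the perturbation `∑ (a_n − 1) Λ_k(n)` would be `o(x (log x)^{k−1})`, contradicting
`eventually_perturbation_ge`. [cite: Ford2004, Theorem 1 and §2 p. 5] -/
theorem not_isEquivalent_of_local
    (hc : 0 < c) (hX : 2 ≤ X₀)
    (h0 : xs 0 = X₀) (hrec : ∀ j, xs (j + 1) = xs j + xs j * Ford2004.eta c (xs j))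
    (h02 : ∀ n, 0 ≤ a n ∧ a n ≤ 2)
    (ha : ∀ j, ∀ n ∈ Ioc ⌊xs j⌋₊ ⌊xs (j + 1)⌋₊, a n = aloc j n)
    {m : ℕ} {θ Ck xk : ℝ} (hθ : 0 < θ) (hCk : 0 ≤ Ck)
    (h25 : ∀ j, xk ≤ xs j →
      |(∑ n ∈ Ioc ⌊xs j⌋₊ ⌊xs (j + 1)⌋₊, (aloc j n - 1) * generalizedVonMangoldt (m + 1) n)
          - θ * ((Ioc ⌊xs j⌋₊ ⌊xs (j + 1)⌋₊).card : ℝ) * Real.log (xs j) ^ m|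
        ≤ Ck * ((Ioc ⌊xs j⌋₊ ⌊xs (j + 1)⌋₊).card : ℝ) * Real.log (xs j) ^ m
          * Ford2004.eta c (xs j)) :
    ¬ ((fun x : ℝ => ∑ n ∈ Ioc 0 ⌊x⌋₊, a n * generalizedVonMangoldt (m + 1) n) ~[atTop]
        fun x : ℝ => ((m + 1 : ℕ) : ℝ) * x * Real.log x ^ m) := by
  intro h
  have hS := h.isLittleO
  have hM := isLittleO_sum_generalizedVonMangoldt_sub m
  have hP : (fun x : ℝ => ∑ n ∈ Ioc 0 ⌊x⌋₊, (a n - 1) * generalizedVonMangoldt (m + 1) n)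
      =o[atTop] fun x : ℝ => ((m + 1 : ℕ) : ℝ) * x * Real.log x ^ m := by
    refine (hS.sub hM).congr_left fun x => ?_
    simp only [Pi.sub_apply, sub_mul, one_mul, Finset.sum_sub_distrib]
    ring
  have hε : 0 < θ / (4 * ((m + 1 : ℕ) : ℝ)) := by positivity
  obtain ⟨x, hx1, hxP, hxlow⟩ := ((eventually_gt_atTop (1 : ℝ)).and ((hP.def hε).and
    (eventually_perturbation_ge hc hX h0 hrec h02 ha hθ hCk h25))).exists
  have hx0 : 0 < x := by linarith
  have hL0 : 0 < Real.log x := Real.log_pos hx1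
  have hpos : 0 < x * Real.log x ^ m := by positivity
  have hg : 0 < ((m + 1 : ℕ) : ℝ) * x * Real.log x ^ m := by positivity
  rw [Real.norm_eq_abs, Real.norm_eq_abs, abs_of_pos hg] at hxP
  have h1 := (abs_le.mp hxP).2
  have h2 : θ / (4 * ((m + 1 : ℕ) : ℝ)) * (((m + 1 : ℕ) : ℝ) * x * Real.log x ^ m) =
      θ / 4 * (x * Real.log x ^ m) := by
    field_simp
  rw [h2] at h1
  nlinarith

end Sk

end Ford2004

/-! ## Theorem 1 from the local construction -/

/-- **Ford's Theorem 1 (first assertion) from the local construction** ([Ford2004] §2, p. 5: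
"Deducing Theorems 1 and 2 from (2.3)–(2.6) is straightforward"). Given the local construction
`Literature.NumberTheory.Sieve.Ford2004_localConstruction` ([Ford2004] Theorem 3 with the choice of
`f_{1_M}` of the proof of Theorem 1), for every `ν ∈ (0, 1)` the sequence obtained by gluing the
local data with `σ_j = 1` on the intervals `I_j = (x_j, x_{j+1}]`, `x_{j+1} = x_j(1 + e^{−c₁√log x_j})`
(and `a_n = 1` below `x_0`) is non-negative, satisfies `R(ν)` with `A(x) = x`, `g(d) = 1/d`
(`Ford2004.typeI_isBigO`), and violates `(S_k)` for every `k ≥ 1`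
(`Ford2004.not_isEquivalent_of_local`: `T_k(x) → 1 + θ_k/k`, case (ii) of Theorem 1). Hence
`FordFixedLevelBarrier`. The analytic inputs are the prime number theorem with the
de la Vallée Poussin error term (`ChebyshevPsiDeLaValleePoussin_holds`) and
`∑_{n ≤ x} Λ_k(n) = k x (log x)^{k−1} + O(x (log x)^{k−2})` (`BombieriSieve.FI1978_lemma3_rat_explicit`),
both PROVED in the tree. [cite: Ford2004, Theorem 1 and §2 (deduction from Theorem 3)] -/
theorem FordFixedLevelBarrier_of_localConstruction (hF : Ford2004_localConstruction) :
    FordFixedLevelBarrier := by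
  intro ν hν0 hν1
  obtain ⟨ϖ, hϖ0, hϖ1, c₁, hc₁, θ, hθ, C, Ck, xk, x₀, hloc⟩ := hF ν hν0 hν1
  -- the end-points `x_j`, started at `X₀ = max x₀ 2`
  have hX : (2 : ℝ) ≤ max x₀ 2 := le_max_right _ _
  have hX0 : (0 : ℝ) < max x₀ 2 := by linarith
  obtain ⟨xs, h0, hrec⟩ : ∃ xs : ℕ → ℝ, xs 0 = max x₀ 2 ∧
      ∀ j, xs (j + 1) = xs j + xs j * Ford2004.eta c₁ (xs j) :=
    ⟨fun j => Nat.rec (max x₀ 2) (fun _ x => x + x * Ford2004.eta c₁ x) j, rfl, fun _ => rfl⟩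
  have hxs0 : ∀ j, x₀ ≤ xs j := by
    intro j
    have h1 := Ford2004.xs_mono hX0 h0 hrec (Nat.zero_le j)
    rw [h0] at h1
    exact le_trans (le_max_left _ _) h1
  -- the local data on each interval, with the sign `σ_j = 1`
  choose aloc haloc using fun j => hloc (xs j) (hxs0 j) 1 (Or.inl rfl)
  -- the glued sequence
  have hNmono : Monotone fun j => ⌊xs j⌋₊ := fun i j hij =>
    Nat.floor_le_floor (Ford2004.xs_mono hX0 h0 hrec hij)
  obtain ⟨a, ha, ha1⟩ := Ford2004.exists_glue hNmono aloc
  have h23 : ∀ j n, 0 ≤ aloc j n ∧ aloc j n ≤ 2 := fun j n => (haloc j).1 n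
  have h02 : ∀ n, 0 ≤ a n ∧ a n ≤ 2 := Ford2004.glue_bounds h23 ha ha1
  refine ⟨a, fun n => (h02 n).1, ?_, ?_⟩
  · -- `R(ν)`
    intro B _hB
    have h24 : ∀ j (d : ℕ), 1 ≤ d → (d : ℝ) ≤ xs j ^ (1 - ϖ) →
        |(∑ n ∈ (Ioc ⌊xs j⌋₊ ⌊xs (j + 1)⌋₊).filter (d ∣ ·), aloc j n)
            - ((Ioc ⌊xs j⌋₊ ⌊xs (j + 1)⌋₊).card : ℝ) / d|
          ≤ max C 0 * (((Ioc ⌊xs j⌋₊ ⌊xs (j + 1)⌋₊).card : ℝ) / d * Ford2004.eta c₁ (xs j)) := by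
      intro j d hd1 hd2
      have h := (haloc j).2.1 d hd1 hd2
      rw [← hrec j] at h
      refine h.trans ?_
      rw [mul_assoc]
      refine mul_le_mul_of_nonneg_right (le_max_left _ _) ?_
      exact mul_nonneg (div_nonneg (Nat.cast_nonneg _) (Nat.cast_nonneg _))
        (Ford2004.eta_pos _ _).le
    exact Ford2004.typeI_isBigO hν0 hν1 hϖ0 hϖ1 hc₁ (le_max_right C 0) hX h0 hrec h02 ha h24 B
  · -- `(S_k)` fails for every `k ≥ 1`
    intro k hk
    obtain ⟨m, rfl⟩ : ∃ m, k = m + 1 := ⟨k - 1, by omega⟩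
    simp only [Nat.add_sub_cancel]
    have hpos := Ford2004.xs_pos hX0 h0 hrec
    have h25 : ∀ j, xk (m + 1) ≤ xs j →
        |(∑ n ∈ Ioc ⌊xs j⌋₊ ⌊xs (j + 1)⌋₊, (aloc j n - 1) * generalizedVonMangoldt (m + 1) n)
            - θ (m + 1) * ((Ioc ⌊xs j⌋₊ ⌊xs (j + 1)⌋₊).card : ℝ) * Real.log (xs j) ^ m|
          ≤ max (Ck (m + 1)) 0 * ((Ioc ⌊xs j⌋₊ ⌊xs (j + 1)⌋₊).card : ℝ) * Real.log (xs j) ^ m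
            * Ford2004.eta c₁ (xs j) := by
      intro j hj
      have h := (haloc j).2.2 (m + 1) (by omega) hj
      rw [← hrec j] at h
      simp only [Nat.add_sub_cancel, one_mul] at h
      refine h.trans ?_
      have hL : 0 ≤ Real.log (xs j) := by
        refine Real.log_nonneg ?_
        have h1 := Ford2004.xs_mono hX0 h0 hrec (Nat.zero_le j)
        rw [h0] at h1
        linarith
      have h2 : 0 ≤ ((Ioc ⌊xs j⌋₊ ⌊xs (j + 1)⌋₊).card : ℝ) * Real.log (xs j) ^ m
          * Ford2004.eta c₁ (xs j) :=
        mul_nonneg (mul_nonneg (Nat.cast_nonneg _) (pow_nonneg hL m)) (Ford2004.eta_pos _ _).le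
      calc Ck (m + 1) * ((Ioc ⌊xs j⌋₊ ⌊xs (j + 1)⌋₊).card : ℝ) * Real.log (xs j) ^ m
            * Ford2004.eta c₁ (xs j)
          = Ck (m + 1) * (((Ioc ⌊xs j⌋₊ ⌊xs (j + 1)⌋₊).card : ℝ) * Real.log (xs j) ^ m
            * Ford2004.eta c₁ (xs j)) := by ring
        _ ≤ max (Ck (m + 1)) 0 * (((Ioc ⌊xs j⌋₊ ⌊xs (j + 1)⌋₊).card : ℝ) * Real.log (xs j) ^ m
            * Ford2004.eta c₁ (xs j)) := mul_le_mul_of_nonneg_right (le_max_left _ _) h2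
        _ = _ := by ring
    exact Ford2004.not_isEquivalent_of_local hc₁ hX h0 hrec h02 ha (hθ (m + 1) (by omega))
      (le_max_right _ 0) h25

/-- **Ford's fixed-level barrier holds** ([Ford2004] Theorem 1, first assertion): DISCHARGE of the
catalogue fact `FordFixedLevelBarrier` — the local construction `Ford2004_localConstruction` is
now a theorem of the tree (`Literature.NumberTheory.Sieve.Ford2004_localConstruction_holds`,
`FordAsymptoticSieveProofs.lean`: Ford's Theorem 3 for the product choice of `f_{1_M}`, from the
prime number theorem with the de la Vallée Poussin error term), and Theorem 1 follows from it by
`FordFixedLevelBarrier_of_localConstruction` (the deduction of [Ford2004] §2, p. 5).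
[cite: Ford2004, Theorem 1] -/
theorem FordFixedLevelBarrier_holds : FordFixedLevelBarrier :=
  FordFixedLevelBarrier_of_localConstruction
    Literature.NumberTheory.Sieve.Ford2004_localConstruction_holds

end Literature.Barriers.Parity
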